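import Literature.NumberTheory.LFunctions.FordIncompleteLemma41
import Literature.NumberTheory.LFunctions.FordIncompleteL42Params
import Literature.NumberTheory.LFunctions.FordIncompleteJt
import HarnessLib

/-!
# Ford's Lemma 4.2 (iterating Lemma 4.1 along `M_j ≤ M ≤ P_j`), with the library's constants

Topic `Literature/NumberTheory/LFunctions`. Everything here is PROVED.

K. Ford, Proc. LMS 85 (2002), **Lemma 4.2**: the induction (4.13) on `j ≤ L` bounding
`H_j(M) = J_{tj,k,h}(𝒞(M,R))` for `M_j ≤ M ≤ P_j`, `P_j = P^{α^{L−j}}`,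
`M_j = P^{α^{L−j}} R^{−h(1−α^{L−j})}`, `α = 1 − 1/h`, fed by Lemma 4.1 (here the tree's
`FordVK.ford_lemma41`, i.e. Lemma 4.1 with `r = h`, diagonal constant `(tk)^t` and the constants
`16/3, 4^{N₀}(t(t+1))^{N₀}e^{1/η}, 8/3, (k^t)^{N₁}`) and by (4.14) in the form
`|𝒞(M,R)| ≤ M (2.2ν)^{1/ν}` (`FordVK.card_C_le_nu`). The result is Ford's Lemma 4.2 with `12η`
in place of `10η` and `C₁ = (tk)^t` in place of `k^t` (the `E_j` are unchanged):

for `k ≥ 60`, `h + t = k + 1`, `1 ≤ t`, `6t ≤ k`, `1 ≤ L`, `2L ≤ h`, `0 < η`, `3ηh ≤ 2`, `R = P^η`,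
`R ≥ (2/η)³`, `R ≥ e⁴⁰`, and `|𝒞(Q,R)| ≥ Q^{1/2}` for `P^{1/3} ≤ Q ≤ P` ((4.11)):

`J_{Lt,k,h}(𝒞(P,R)) ≤ (12η)^{tL((1/η+h)α^{L−1} − h)} C_L (e²R)^{t L(L−1)/2} P^{t(2L − h(1−α^L))}`,

`C_1 = (tk)^t`, `C_j = max(C_{j−1}, e^{tE_j})`, `E_j = α^{L−j}[(4 log k/η)(j−1) − f_j log P]`,
`f_j = j − (j−1)/h − h(1−α^j)` (`FordVK.fj`). (Note `t(2L − h(1−α^L)) = 2Lt − (t/2)(h+k) + Δ_L`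
since `h + k = 2h + t − 1`.)

* `FordVK.L42Ctx` — the data and hypotheses; `P_j, M_j, η₁, E_j, C_j`;
* `FordVK.L42Ctx.claim_all` — (4.13) for all `1 ≤ j ≤ L`;
* `FordVK.ford_lemma42` — the lemma.

## References

* K. Ford, *Vinogradov's integral and bounds for the Riemann zeta function*, Proc. London Math.
  Soc. (3) 85 (2002), 565–633; arXiv:1910.08209 — Lemma 4.2 and its proof ((4.12)–(4.15)).
  [Ford2002]
-/

noncomputable section

open Finset MeasureTheory ArithmeticFunction
open scoped Real ArithmeticFunction.Omega

namespace Literature.NumberTheory.LFunctions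
namespace FordVK

open VMV FordSmooth

/-! ### Small real-analysis facts -/

/-- `log(1 − 1/h) ≥ −1/(h−1)` for `h > 1`. [folklore] -/
theorem log_alpha_ge {h : ℝ} (hh : 1 < h) : -(1 / (h - 1)) ≤ Real.log (1 - 1 / h) := by
  have hα : 0 < 1 - 1 / h := by
    have : 1 / h < 1 := by rw [div_lt_one (by linarith)]; exact hh
    linarith
  have := Real.one_sub_inv_le_log_of_pos hα
  refine le_trans (le_of_eq ?_) this
  have h0 : h ≠ 0 := by linarith
  have h1 : h - 1 ≠ 0 := by linarith
  field_simp
  ring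

/-- `α^{⌊h/2⌋} ≥ 0.6` in the form: for `2n ≤ h`, `h ≥ 50`, `(1 − 1/h)^n ≥ 0.6`. [cite: Ford2002, (4.12)
("P^{α^L} R^{−h(1−α^L)} ≥ P^{0.6}R^{−0.4h}")] -/
theorem alpha_pow_ge_06 {h : ℝ} (hh : 50 ≤ h) {n : ℕ} (hn : 2 * (n : ℝ) ≤ h) : (0.6 : ℝ) ≤ (1 - 1 / h) ^ n := by
  have hα : 0 < 1 - 1 / h := by
    have : 1 / h ≤ 1 / 50 := div_le_div_of_nonneg_left (by norm_num) (by norm_num) hh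
    linarith
  rw [← Real.exp_log (pow_pos hα n), Real.log_pow]
  have hlog := log_alpha_ge (h := h) (by linarith)
  have h1 : -(0.5103 : ℝ) ≤ (n : ℝ) * Real.log (1 - 1 / h) := by
    have h2 : (n : ℝ) * (1 / (h - 1)) ≤ 0.5103 := by
      rw [← mul_div_assoc, mul_one, div_le_iff₀ (by linarith)]; nlinarith
    have hn0 : (0 : ℝ) ≤ n := Nat.cast_nonneg _
    nlinarith
  have h3 : Real.exp (-(0.5103 : ℝ)) ≤ Real.exp ((n : ℝ) * Real.log (1 - 1 / h)) := Real.exp_le_exp.2 h1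
  refine le_trans ?_ h3
  -- `0.6 ≤ e^{-0.5103}` ⟸ `e^{0.5103} ≤ 5/3`
  rw [Real.exp_neg, le_inv_comm₀ (by norm_num) (Real.exp_pos _)]
  have h := Real.exp_bound (x := 0.5103) (by norm_num) (n := 4) (by norm_num)
  simp only [Finset.sum_range_succ, Finset.sum_range_zero, Nat.factorial] at h
  norm_num at h
  have := (abs_le.1 h).2
  linarith

/-- `e^{1.5 h} ≥ 0.033·... `: the polynomial-vs-exponential comparison of the `T₁` branch, in the form
`0.033 k⁶ ≤ e^{1.25 k}` for `k ≥ 60`. [folklore] -/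
theorem poly_le_exp_T1 {k : ℝ} (hk : 60 ≤ k) : 0.033 * k ^ 6 ≤ Real.exp (1.25 * k) := by
  have h := Real.pow_div_factorial_le_exp (x := 1.25 * k) (by positivity) 8
  have h8 : (Nat.factorial 8 : ℝ) = 40320 := by norm_num [Nat.factorial]
  rw [h8] at h
  refine le_trans ?_ h
  rw [le_div_iff₀ (by norm_num), mul_pow]
  have hk2 : (3600 : ℝ) ≤ k ^ 2 := by nlinarith
  have hk6 : (0 : ℝ) ≤ k ^ 6 := by positivity
  have hA : (0.033 * 40320 : ℝ) ≤ (1.25 : ℝ) ^ 8 * k ^ 2 := by norm_num; nlinarith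
  calc 0.033 * k ^ 6 * 40320 = (0.033 * 40320) * k ^ 6 := by ring
    _ ≤ ((1.25 : ℝ) ^ 8 * k ^ 2) * k ^ 6 := mul_le_mul_of_nonneg_right hA hk6
    _ = _ := by ring

/-! ### The data of Lemma 4.2 -/

/-- The data and hypotheses of Lemma 4.2 (library version). [cite: Ford2002, Lemma 4.2 ((4.9)–(4.11))] -/
structure L42Ctx where
  /-- Ford's `k` -/
  k : ℕ
  /-- Ford's `h` -/
  h : ℕ
  /-- `t = k − h + 1` -/
  t : ℕ
  /-- Ford's `L` -/
  L : ℕ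
  /-- Ford's `P` -/
  P : ℝ
  /-- `R = P^η` -/
  R : ℝ
  /-- Ford's `η` -/
  η : ℝ
  hk : 60 ≤ k
  hkt : h + t = k + 1
  ht1 : 1 ≤ t
  ht6 : 6 * t ≤ k
  hL1 : 1 ≤ L
  hL2 : 2 * L ≤ h
  hη : 0 < η
  hηh : 3 * η * h ≤ 2
  hP : 1 < P
  hR : R = P ^ η
  hR3 : (2 / η) ^ 3 ≤ R
  hR40 : Real.exp 40 ≤ R
  h411 : ∀ Q : ℝ, P ^ (1 / 3 : ℝ) ≤ Q → Q ≤ P → Q ^ (1 / 2 : ℝ) ≤ ((smoothSet Q R).card : ℝ)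

namespace L42Ctx

variable (c : L42Ctx)

/-- `α = 1 − 1/h`. [cite: Ford2002, Lemma 4.2] -/
def α : ℝ := 1 - 1 / (c.h : ℝ)
/-- `P_j = P^{α^{L−j}}`. [cite: Ford2002, proof of Lemma 4.2] -/
def Pw (j : ℕ) : ℝ := c.P ^ (c.α ^ (c.L - j))
/-- `M_j = P^{α^{L−j}} R^{−h(1−α^{L−j})}`. [cite: Ford2002, proof of Lemma 4.2] -/
def Mw (j : ℕ) : ℝ := c.P ^ (c.α ^ (c.L - j)) * c.R ^ (-((c.h : ℝ) * (1 - c.α ^ (c.L - j))))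
/-- `η₁ = log R / log M₁`. [cite: Ford2002, proof of Lemma 4.2] -/
def η₁ : ℝ := Real.log c.R / Real.log (c.Mw 1)
/-- `ν(M) = log R / log M`. [cite: Ford2002, proof of Lemma 4.2 ("Writing ν = log M/log R" — here the reciprocal convention `ν = log R/log M ≤ 3η`)] -/
def ν (M : ℝ) : ℝ := Real.log c.R / Real.log M
/-- `E_j = α^{L−j}[(4 log k/η)(j−1) − f_j log P]`. [cite: Ford2002, Lemma 4.2] -/
def E (j : ℕ) : ℝ := c.α ^ (c.L - j) * (4 * Real.log c.k / c.η * ((j : ℝ) - 1) - fj c.h j * Real.log c.P)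
/-- `C_1 = (tk)^t`, `C_j = max(C_{j−1}, e^{tE_j})`. [cite: Ford2002, Lemma 4.2 (`C_ℓ`)] -/
def Cseq : ℕ → ℝ
  | 0 => ((c.t * c.k : ℕ) : ℝ) ^ c.t
  | 1 => ((c.t * c.k : ℕ) : ℝ) ^ c.t
  | j + 2 => max (Cseq (j + 1)) (Real.exp (c.t * c.E (j + 2)))
/-- The constant `K₁ = (12η)^{1/η₁}`. [cite: Ford2002, (4.13) (`(10η)^{tj/η₁}`)] -/
def K₁ : ℝ := (12 * c.η) ^ (1 / c.η₁)
/-- The exponent `X_j = t(2j − h(1 − α^j))` (`= 2jt − (t/2)(h+k) + Δ_j`). [cite: Ford2002, (4.13)] -/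
def X (j : ℕ) : ℝ := c.t * (2 * (j : ℝ) - c.h * (1 - c.α ^ j))
/-- `H_j(M) = J_{tj,k,h}(𝒞(M,R))`. [cite: Ford2002, proof of Lemma 4.2] -/
def H (j : ℕ) (M : ℝ) : ℝ := (Jinc c.k (c.t * j) ((smoothSet M c.R).map Nat.castEmbedding) c.h c.k : ℝ)
/-- **(4.13)** at level `j`. [cite: Ford2002, (4.13)] -/
def Claim (j : ℕ) : Prop :=
  ∀ M : ℝ, c.Mw j ≤ M → M ≤ c.Pw j →
    c.H j M ≤ c.K₁ ^ (c.t * j) * c.Cseq j * (Real.exp 2 * c.R) ^ (c.t * j.choose 2) * M ^ c.X j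

/-! #### Sizes of `k, h, t, η` -/

/-- Auxiliary step (elementary consequence of the definitions and the standing hypotheses). [folklore] -/
theorem k_geR : (60 : ℝ) ≤ c.k := by exact_mod_cast c.hk
/-- Auxiliary step (elementary consequence of the definitions and the standing hypotheses). [folklore] -/
theorem k_pos : (0 : ℝ) < c.k := by linarith [c.k_geR]
/-- Auxiliary step (elementary consequence of the definitions and the standing hypotheses). [folklore] -/
theorem t_pos : (0 : ℝ) < c.t := by exact_mod_cast (show 0 < c.t from c.ht1)
/-- Auxiliary step (elementary consequence of the definitions and the standing hypotheses). [folklore] -/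
theorem one_le_tR : (1 : ℝ) ≤ c.t := by exact_mod_cast c.ht1
/-- Auxiliary step (elementary consequence of the definitions and the standing hypotheses). [folklore] -/
theorem h_ge : 51 ≤ c.h := by have := c.hkt; have := c.ht6; have := c.hk; omega
/-- Auxiliary step (elementary consequence of the definitions and the standing hypotheses). [folklore] -/
theorem h_geR : (51 : ℝ) ≤ c.h := by exact_mod_cast c.h_ge
/-- Auxiliary step (elementary consequence of the definitions and the standing hypotheses). [folklore] -/
theorem h_pos : (0 : ℝ) < c.h := by linarith [c.h_geR]
/-- Auxiliary step (elementary consequence of the definitions and the standing hypotheses). [folklore] -/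
theorem one_le_h : 1 ≤ c.h := le_trans (by norm_num) c.h_ge
/-- Auxiliary step (elementary consequence of the definitions and the standing hypotheses). [folklore] -/
theorem h_le_k : c.h ≤ c.k := by have := c.hkt; have := c.ht1; omega
/-- Auxiliary step (elementary consequence of the definitions and the standing hypotheses). [folklore] -/
theorem hkt_R : (c.h : ℝ) + c.t = c.k + 1 := by exact_mod_cast c.hkt
/-- Auxiliary step (elementary consequence of the definitions and the standing hypotheses). [folklore] -/
theorem six_t_le : 6 * (c.t : ℝ) ≤ c.k := by exact_mod_cast c.ht6
/-- Auxiliary step (elementary consequence of the definitions and the standing hypotheses). [folklore] -/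
theorem k_le : (c.k : ℝ) ≤ 6 / 5 * c.h := by have := c.hkt_R; have := c.six_t_le; linarith
/-- Auxiliary step (elementary consequence of the definitions and the standing hypotheses). [folklore] -/
theorem two_L_le : 2 * (c.L : ℝ) ≤ c.h := by exact_mod_cast c.hL2
/-- Auxiliary step (elementary consequence of the definitions and the standing hypotheses). [folklore] -/
theorem L_pos : 0 < c.L := c.hL1
/-- Auxiliary step (elementary consequence of the definitions and the standing hypotheses). [folklore] -/
theorem η_le : c.η ≤ 2 / (3 * c.h) := by
  rw [le_div_iff₀ (by linarith [c.h_pos])]; linarith [c.hηh]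
/-- Auxiliary step (elementary consequence of the definitions and the standing hypotheses). [folklore] -/
theorem η_le' : c.η ≤ 1 / 75 := by
  have := c.η_le
  have : 2 / (3 * (c.h : ℝ)) ≤ 2 / (3 * 51) := div_le_div_of_nonneg_left (by norm_num) (by norm_num) (by linarith [c.h_geR])
  linarith
/-- Auxiliary step (elementary consequence of the definitions and the standing hypotheses). [folklore] -/
theorem hη_le : (c.h : ℝ) * c.η ≤ 2 / 3 := by linarith [c.hηh]
/-- Auxiliary step (elementary consequence of the definitions and the standing hypotheses). [folklore] -/
theorem twelve_η_le_one : 12 * c.η ≤ 1 := by linarith [c.η_le']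
/-- Auxiliary step (elementary consequence of the definitions and the standing hypotheses). [folklore] -/
theorem log_k_ge : 4 ≤ Real.log c.k := by
  rw [Real.le_log_iff_exp_le c.k_pos]
  have h1 : Real.exp 4 = Real.exp 1 ^ 4 := by rw [← Real.exp_nat_mul]; norm_num
  rw [h1]; have := Real.exp_one_lt_d9
  calc Real.exp 1 ^ 4 ≤ (2.7182818286 : ℝ) ^ 4 := pow_le_pow_left₀ (Real.exp_pos 1).le this.le 4
    _ ≤ 60 := by norm_num
    _ ≤ c.k := c.k_geR

/-! #### `α` -/

/-- Auxiliary step (elementary consequence of the definitions and the standing hypotheses). [folklore] -/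
theorem α_pos : 0 < c.α := by
  unfold α; have : 1 / (c.h : ℝ) ≤ 1 / 51 := div_le_div_of_nonneg_left (by norm_num) (by norm_num) c.h_geR
  linarith
/-- Auxiliary step (elementary consequence of the definitions and the standing hypotheses). [folklore] -/
theorem α_lt_one : c.α < 1 := by
  unfold α; have := c.h_pos
  have : 0 < 1 / (c.h : ℝ) := by positivity
  linarith
/-- Auxiliary step (elementary consequence of the definitions and the standing hypotheses). [folklore] -/
theorem α_le_one : c.α ≤ 1 := c.α_lt_one.le
/-- Auxiliary step (elementary consequence of the definitions and the standing hypotheses). [folklore] -/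
theorem α_pow_pos (n : ℕ) : 0 < c.α ^ n := pow_pos c.α_pos n
/-- Auxiliary step (elementary consequence of the definitions and the standing hypotheses). [folklore] -/
theorem α_pow_le_one (n : ℕ) : c.α ^ n ≤ 1 := pow_le_one₀ c.α_pos.le c.α_le_one
/-- Auxiliary step (elementary consequence of the definitions and the standing hypotheses). [folklore] -/
theorem α_pow_anti {m n : ℕ} (h : m ≤ n) : c.α ^ n ≤ c.α ^ m := pow_le_pow_of_le_one c.α_pos.le c.α_le_one h
/-- Auxiliary step (elementary consequence of the definitions and the standing hypotheses). [folklore] -/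
theorem h_mul_one_sub_α : (c.h : ℝ) * (1 - c.α) = 1 := by unfold α; field_simp [c.h_pos.ne']; ring
/-- `α^n ≥ 0.6` for `2n ≤ h`. [cite: Ford2002, (4.12)] -/
theorem α_pow_ge_06 {n : ℕ} (hn : 2 * (n : ℝ) ≤ c.h) : (0.6 : ℝ) ≤ c.α ^ n :=
  alpha_pow_ge_06 (by linarith [c.h_geR]) hn
/-- Auxiliary step (elementary consequence of the definitions and the standing hypotheses). [folklore] -/
theorem α_pow_L_ge : (0.6 : ℝ) ≤ c.α ^ c.L := c.α_pow_ge_06 c.two_L_le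
/-- Auxiliary step (elementary consequence of the definitions and the standing hypotheses). [folklore] -/
theorem α_pow_ge_06' {j : ℕ} : (0.6 : ℝ) ≤ c.α ^ (c.L - j) := le_trans c.α_pow_L_ge (c.α_pow_anti (Nat.sub_le _ _))

/-! #### `P, R`, logarithms -/

/-- Auxiliary step (elementary consequence of the definitions and the standing hypotheses). [folklore] -/
theorem P_pos : 0 < c.P := by linarith [c.hP]
/-- Auxiliary step (elementary consequence of the definitions and the standing hypotheses). [folklore] -/
theorem one_le_P : 1 ≤ c.P := c.hP.le
/-- Auxiliary step (elementary consequence of the definitions and the standing hypotheses). [folklore] -/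
theorem logP_pos : 0 < Real.log c.P := Real.log_pos c.hP
/-- Auxiliary step (elementary consequence of the definitions and the standing hypotheses). [folklore] -/
theorem R_pos : 0 < c.R := by rw [c.hR]; exact Real.rpow_pos_of_pos c.P_pos _
/-- Auxiliary step (elementary consequence of the definitions and the standing hypotheses). [folklore] -/
theorem logR_eq : Real.log c.R = c.η * Real.log c.P := by rw [c.hR, Real.log_rpow c.P_pos]
/-- Auxiliary step (elementary consequence of the definitions and the standing hypotheses). [folklore] -/
theorem logR_pos : 0 < Real.log c.R := by rw [c.logR_eq]; exact mul_pos c.hη c.logP_pos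
/-- Auxiliary step (elementary consequence of the definitions and the standing hypotheses). [folklore] -/
theorem one_lt_R : 1 < c.R := by
  have := c.logR_pos; rwa [Real.log_pos_iff c.R_pos.le] at this
/-- Auxiliary step (elementary consequence of the definitions and the standing hypotheses). [folklore] -/
theorem logR_ge_40 : 40 ≤ Real.log c.R := by
  rw [Real.le_log_iff_exp_le c.R_pos]; exact c.hR40
/-- Auxiliary step (elementary consequence of the definitions and the standing hypotheses). [folklore] -/
theorem R_ge_k_cubed : (c.k : ℝ) ^ 3 ≤ c.R := by
  refine le_trans ?_ c.hR3
  have : (c.k : ℝ) ≤ 2 / c.η := by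
    rw [le_div_iff₀ c.hη]; have := c.hη_le; have := c.k_le; have := c.h_pos; nlinarith
  exact pow_le_pow_left₀ c.k_pos.le this 3
/-- Auxiliary step (elementary consequence of the definitions and the standing hypotheses). [folklore] -/
theorem k_lt_sqrt_R : (c.k : ℝ) < Real.sqrt c.R := by
  rw [Real.lt_sqrt c.k_pos.le]
  have := c.R_ge_k_cubed; have := c.k_geR; nlinarith
/-- Auxiliary step (elementary consequence of the definitions and the standing hypotheses). [folklore] -/
theorem one_le_floor_R : 1 ≤ ⌊c.R⌋₊ := Nat.le_floor (by have := c.one_lt_R; norm_num; linarith)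
/-- `R = M^{ν(M)}` for `M > 1`. [folklore] -/
theorem R_eq_rpow_ν {M : ℝ} (hM : 1 < M) : c.R = M ^ c.ν M := by
  unfold ν
  rw [Real.rpow_def_of_pos (by linarith), mul_comm, div_mul_cancel₀ _ (Real.log_pos hM).ne', Real.exp_log c.R_pos]

/-! #### `P_j`, `M_j` -/

/-- Auxiliary step (elementary consequence of the definitions and the standing hypotheses). [folklore] -/
theorem Pw_pos (j : ℕ) : 0 < c.Pw j := Real.rpow_pos_of_pos c.P_pos _
/-- Auxiliary step (elementary consequence of the definitions and the standing hypotheses). [folklore] -/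
theorem Mw_pos (j : ℕ) : 0 < c.Mw j := mul_pos (Real.rpow_pos_of_pos c.P_pos _) (Real.rpow_pos_of_pos c.R_pos _)
/-- Auxiliary step (elementary consequence of the definitions and the standing hypotheses). [folklore] -/
theorem Pw_L : c.Pw c.L = c.P := by unfold Pw; simp
/-- Auxiliary step (elementary consequence of the definitions and the standing hypotheses). [folklore] -/
theorem Mw_L : c.Mw c.L = c.P := by unfold Mw; simp
/-- Auxiliary step (elementary consequence of the definitions and the standing hypotheses). [folklore] -/
theorem Pw_le_P (j : ℕ) : c.Pw j ≤ c.P := by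
  unfold Pw
  calc c.P ^ (c.α ^ (c.L - j)) ≤ c.P ^ (1 : ℝ) := Real.rpow_le_rpow_of_exponent_le c.one_le_P (c.α_pow_le_one _)
    _ = c.P := Real.rpow_one _
/-- `M_j = P^{α^{L−j}(1 + hη) − hη}` as a power of `P`. [folklore] -/
theorem Mw_eq (j : ℕ) : c.Mw j = c.P ^ (c.α ^ (c.L - j) * (1 + c.h * c.η) - c.h * c.η) := by
  unfold Mw
  rw [c.hR, ← Real.rpow_mul c.P_pos.le, ← Real.rpow_add c.P_pos]
  congr 1; ring
/-- Auxiliary step (elementary consequence of the definitions and the standing hypotheses). [folklore] -/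
theorem Mw_le_Pw (j : ℕ) : c.Mw j ≤ c.Pw j := by
  rw [c.Mw_eq]; unfold Pw
  refine Real.rpow_le_rpow_of_exponent_le c.one_le_P ?_
  have h1 := c.α_pow_le_one (c.L - j)
  have hx : 0 ≤ (1 - c.α ^ (c.L - j)) * (c.h * c.η) := mul_nonneg (by linarith) (by have := c.hη; have := c.h_pos; positivity)
  nlinarith
/-- The exponent of `M_j` is at least `1/3`. [cite: Ford2002, (4.12) ("M_j ≥ P^{0.6}R^{−0.4h} ≥ P^{1/3}")] -/
theorem Mw_exp_ge (j : ℕ) : (1 / 3 : ℝ) ≤ c.α ^ (c.L - j) * (1 + c.h * c.η) - c.h * c.η := by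
  have h1 := c.α_pow_ge_06' (j := j)
  have h2 := c.hη_le; have h3 : 0 ≤ (c.h : ℝ) * c.η := by have := c.hη; have := c.h_pos; positivity
  nlinarith
/-- Auxiliary step (elementary consequence of the definitions and the standing hypotheses). [folklore] -/
theorem cbrt_P_le_Mw (j : ℕ) : c.P ^ (1 / 3 : ℝ) ≤ c.Mw j := by
  rw [c.Mw_eq]; exact Real.rpow_le_rpow_of_exponent_le c.one_le_P (c.Mw_exp_ge j)
/-- Auxiliary step (elementary consequence of the definitions and the standing hypotheses). [folklore] -/
theorem one_lt_Mw (j : ℕ) : 1 < c.Mw j := by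
  refine lt_of_lt_of_le ?_ (c.cbrt_P_le_Mw j)
  exact Real.one_lt_rpow c.hP (by norm_num)
/-- Auxiliary step (elementary consequence of the definitions and the standing hypotheses). [folklore] -/
theorem Mw_mono {i j : ℕ} (hij : i ≤ j) (hj : j ≤ c.L) : c.Mw i ≤ c.Mw j := by
  rw [c.Mw_eq, c.Mw_eq]
  refine Real.rpow_le_rpow_of_exponent_le c.one_le_P ?_
  have h1 : c.α ^ (c.L - i) ≤ c.α ^ (c.L - j) := c.α_pow_anti (by omega)
  have h2 := mul_le_mul_of_nonneg_right h1 (by have := c.hη; have := c.h_pos; positivity : (0:ℝ) ≤ 1 + c.h * c.η)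
  linarith
/-- `R ≤ M_j` (so `ν ≤ 1`). [cite: Ford2002, (4.12)] -/
theorem R_le_Mw (j : ℕ) : c.R ≤ c.Mw j := by
  refine le_trans ?_ (c.cbrt_P_le_Mw j)
  rw [c.hR]
  refine Real.rpow_le_rpow_of_exponent_le c.one_le_P ?_
  linarith [c.η_le']

/-! #### `ν(M)` on `[M_j, P_j]`, `η₁` -/

/-- Auxiliary step (elementary consequence of the definitions and the standing hypotheses). [folklore] -/
theorem ν_pos {M : ℝ} (hM : 1 < M) : 0 < c.ν M := div_pos c.logR_pos (Real.log_pos hM)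
/-- `ν(M) ≥ η` for `M ≤ P`. [cite: Ford2002, proof of Lemma 4.2 ("η ≤ η_j'")] -/
theorem η_le_ν {M : ℝ} (hM1 : 1 < M) (hMP : M ≤ c.P) : c.η ≤ c.ν M := by
  unfold ν; rw [le_div_iff₀ (Real.log_pos hM1), c.logR_eq]
  exact mul_le_mul_of_nonneg_left (Real.log_le_log (by linarith) hMP) c.hη.le
/-- `ν(M) ≤ ν(M')` for `M' ≤ M`. [folklore] -/
theorem ν_anti {M M' : ℝ} (hM' : 1 < M') (h : M' ≤ M) : c.ν M ≤ c.ν M' :=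
  div_le_div_of_nonneg_left c.logR_pos.le (Real.log_pos hM') (Real.log_le_log (by linarith) h)
/-- Auxiliary step (elementary consequence of the definitions and the standing hypotheses). [folklore] -/
theorem η₁_eq : c.η₁ = c.ν (c.Mw 1) := rfl
/-- Auxiliary step (elementary consequence of the definitions and the standing hypotheses). [folklore] -/
theorem η₁_pos : 0 < c.η₁ := c.ν_pos (c.one_lt_Mw 1)
/-- `ν(M) ≤ η₁` for `M ≥ M_j`, `j ≥ 1`. [cite: Ford2002, proof of Lemma 4.2 ("η_j ≤ η₁")] -/
theorem ν_le_η₁ {j : ℕ} (hj1 : 1 ≤ j) (hj : j ≤ c.L) {M : ℝ} (hM : c.Mw j ≤ M) : c.ν M ≤ c.η₁ := by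
  rw [c.η₁_eq]
  exact c.ν_anti (c.one_lt_Mw 1) ((c.Mw_mono hj1 hj).trans hM)
/-- `1/η₁ = (1/η + h)α^{L−1} − h`. [cite: Ford2002, Lemma 4.2 (the exponent `tL((1/η+h)α^{L−1} − h)`)] -/
theorem inv_η₁ : 1 / c.η₁ = (1 / c.η + c.h) * c.α ^ (c.L - 1) - c.h := by
  unfold η₁
  rw [c.Mw_eq, Real.log_rpow c.P_pos, c.logR_eq, one_div_div]
  have := c.logP_pos; have := c.hη
  field_simp
/-- `η₁ ≤ 3η`. [cite: Ford2002, proof of Lemma 4.2 ("η₁ ≤ 3η")] -/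
theorem η₁_le : c.η₁ ≤ 3 * c.η := by
  have h1 : 1 / (3 * c.η) ≤ 1 / c.η₁ := by
    rw [c.inv_η₁]
    have := c.Mw_exp_ge 1; have := c.hη
    have e : (1 / c.η + c.h) * c.α ^ (c.L - 1) - c.h = (c.α ^ (c.L - 1) * (1 + c.h * c.η) - c.h * c.η) / c.η := by
      field_simp
    rw [e, div_le_div_iff₀ (by positivity) c.hη]
    nlinarith
  have := c.hη
  exact (one_div_le_one_div (by positivity) c.η₁_pos).1 h1
/-- `ν(M) ≤ 3η` and `ν(M) ≤ 1` on the ranges. [folklore] -/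
theorem ν_le_one {M : ℝ} (hM1 : 1 < M) (hRM : c.R ≤ M) : c.ν M ≤ 1 := by
  unfold ν; rw [div_le_one (Real.log_pos hM1)]; exact Real.log_le_log c.R_pos hRM

/-! #### The smooth sets on the range -/

/-- `|𝒞(M,R)| ≤ M (2.2 ν)^{1/ν}` for `M ≥ M_j`. [cite: Ford2002, (4.14)] -/
theorem card_C_le {M : ℝ} (hRM : c.R ≤ M) (hM1 : 1 < M) (hMP : M ≤ c.P) :
    ((smoothSet M c.R).card : ℝ) ≤ M * (2.2 * c.ν M) ^ (1 / c.ν M) := by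
  have h := card_C_le_nu (M := M) (R := c.R) c.hR40 hRM ?_
  · convert h using 2
    unfold ν; field_simp
  · -- `(2 log M / log R)^3 ≤ R`
    refine le_trans ?_ c.hR3
    have hν := c.η_le_ν hM1 hMP
    unfold ν at hν
    have hlogM := Real.log_pos hM1
    have h1 : Real.log M / Real.log c.R ≤ 1 / c.η := by
      rw [div_le_div_iff₀ c.logR_pos c.hη]
      rw [le_div_iff₀ hlogM] at hν; linarith
    have h0 : 0 ≤ 2 * (Real.log M / Real.log c.R) := by have := c.logR_pos; positivity
    calc (2 * (Real.log M / Real.log c.R)) ^ 3 ≤ (2 * (1 / c.η)) ^ 3 := pow_le_pow_left₀ h0 (by linarith) 3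
      _ = (2 / c.η) ^ 3 := by ring

/-- `(2.2ν)^{1/ν} ≤ K₁ = (12η)^{1/η₁}` for `η ≤ ν ≤ η₁`. [cite: Ford2002, proof of Lemma 4.2
("(2ν)^{1/ν} ≤ (6η)^{1/η₁}")] -/
theorem cν_le_K₁ {M : ℝ} (hM1 : 1 < M) (hν1 : c.ν M ≤ c.η₁) : (2.2 * c.ν M) ^ (1 / c.ν M) ≤ c.K₁ := by
  have hν := c.ν_pos hM1
  have h1 : 2.2 * c.ν M ≤ 12 * c.η := by have := c.η₁_le; nlinarith
  have h12 := c.twelve_η_le_one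
  unfold K₁
  calc (2.2 * c.ν M) ^ (1 / c.ν M) ≤ (12 * c.η) ^ (1 / c.ν M) :=
        Real.rpow_le_rpow (by positivity) h1 (by positivity)
    _ ≤ (12 * c.η) ^ (1 / c.η₁) := by
        refine Real.rpow_le_rpow_of_exponent_ge (by have := c.hη; positivity) h12 ?_
        exact div_le_div_of_nonneg_left zero_le_one hν hν1

/-- Auxiliary step (elementary consequence of the definitions and the standing hypotheses). [folklore] -/
theorem K₁_pos : 0 < c.K₁ := by unfold K₁; have := c.hη; exact Real.rpow_pos_of_pos (by positivity) _
/-- Auxiliary step (elementary consequence of the definitions and the standing hypotheses). [folklore] -/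
theorem K₁_le_one : c.K₁ ≤ 1 := by
  unfold K₁; exact Real.rpow_le_one (by have := c.hη; positivity) c.twelve_η_le_one (by have := c.η₁_pos; positivity)

/-- `|𝒞(M,R)| ≥ M^{1/2}` on `[M_j, P]` ((4.11)). [cite: Ford2002, (4.11)] -/
theorem card_C_ge {j : ℕ} {M : ℝ} (hM : c.Mw j ≤ M) (hMP : M ≤ c.P) : M ^ (1 / 2 : ℝ) ≤ ((smoothSet M c.R).card : ℝ) :=
  c.h411 M ((c.cbrt_P_le_Mw j).trans hM) hMP

/-- `|𝒞(M,R)| ≥ 64 t⁴` on the range (hypothesis of Lemma 4.1). [cite: Ford2002, (4.3) and (4.12)] -/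
theorem card_C_ge_64 {j : ℕ} {M : ℝ} (hM : c.Mw j ≤ M) (hMP : M ≤ c.P) :
    (64 : ℝ) * (c.t : ℝ) ^ 4 ≤ ((smoothSet M c.R).card : ℝ) := by
  refine le_trans ?_ (c.card_C_ge hM hMP)
  -- `M^{1/2} ≥ R^{1/2} ≥ k^{3/2} ≥ 64 t⁴`? we use `R ≥ k³` and `M ≥ R`: `M^{1/2} ≥ (k³)^{1/2}`; and `64t⁴ ≤ k^{3/2}` fails,
  -- so instead use `M ≥ P^{1/3} ≥ R^{1/(3η)} ≥ R^{25}`.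
  have hM1 : c.R ^ (25 : ℝ) ≤ M := by
    refine le_trans ?_ ((c.cbrt_P_le_Mw j).trans hM)
    rw [c.hR, ← Real.rpow_mul c.P_pos.le]
    refine Real.rpow_le_rpow_of_exponent_le c.one_le_P ?_
    have := c.η_le'; have := c.hη; nlinarith
  have hM4 : c.R ^ (4 : ℝ) ≤ M := le_trans (Real.rpow_le_rpow_of_exponent_le c.one_lt_R.le (by norm_num)) hM1
  have h2 : (c.R ^ (4 : ℝ)) ^ (1 / 2 : ℝ) ≤ M ^ (1 / 2 : ℝ) :=
    Real.rpow_le_rpow (by have := c.R_pos; positivity) hM4 (by norm_num)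
  refine le_trans ?_ h2
  have h3 : (c.R ^ (4 : ℝ)) ^ (1 / 2 : ℝ) = c.R ^ 2 := by
    rw [← Real.rpow_mul c.R_pos.le]; norm_num
  rw [h3]
  have h4 : ((c.k : ℝ) ^ 3) ^ 2 ≤ c.R ^ 2 := pow_le_pow_left₀ (by have := c.k_pos; positivity) c.R_ge_k_cubed 2
  have h6 : (64 : ℝ) * (c.t : ℝ) ^ 4 ≤ (c.k : ℝ) ^ 6 := by
    have := c.six_t_le; have := c.t_pos; have := c.k_geR
    have ht : (c.t : ℝ) ≤ c.k := by linarith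
    calc (64 : ℝ) * (c.t : ℝ) ^ 4 ≤ 64 * (c.k : ℝ) ^ 4 := by gcongr
      _ ≤ (c.k : ℝ) ^ 2 * (c.k : ℝ) ^ 4 := by gcongr; nlinarith
      _ = (c.k : ℝ) ^ 6 := by ring
  have h5 : ((c.k : ℝ) ^ 3) ^ 2 = (c.k : ℝ) ^ 6 := by ring
  linarith


/-! #### More numerics -/

/-- Auxiliary step (elementary consequence of the definitions and the standing hypotheses). [folklore] -/
theorem exp_two_le : Real.exp 2 ≤ 7.39 := by
  have h : Real.exp 2 = Real.exp 1 ^ 2 := by rw [← Real.exp_nat_mul]; norm_num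
  rw [h]; have := Real.exp_one_lt_d9
  calc Real.exp 1 ^ 2 ≤ (2.7182818286 : ℝ) ^ 2 := pow_le_pow_left₀ (Real.exp_pos 1).le this.le 2
    _ ≤ 7.39 := by norm_num

/-- Auxiliary step (elementary consequence of the definitions and the standing hypotheses). [folklore] -/
theorem sq_83_le_exp_two : (8 / 3 : ℝ) ^ 2 ≤ Real.exp 2 := by
  have h : Real.exp 2 = Real.exp 1 ^ 2 := by rw [← Real.exp_nat_mul]; norm_num
  rw [h]; have := Real.exp_one_gt_d9
  calc (8 / 3 : ℝ) ^ 2 ≤ (2.7182818283 : ℝ) ^ 2 := by norm_num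
    _ ≤ Real.exp 1 ^ 2 := pow_le_pow_left₀ (by norm_num) this.le 2

/-- Auxiliary step (elementary consequence of the definitions and the standing hypotheses). [folklore] -/
theorem one_le_exp_two : (1 : ℝ) ≤ Real.exp 2 := by have := Real.add_one_le_exp (2:ℝ); linarith

/-- `ER = e² R ≥ 1`. [folklore] -/
theorem one_le_ER : (1 : ℝ) ≤ Real.exp 2 * c.R := by
  have := one_le_exp_two; have := c.one_lt_R; nlinarith

/-- Auxiliary step (elementary consequence of the definitions and the standing hypotheses). [folklore] -/
theorem ER_pos : (0 : ℝ) < Real.exp 2 * c.R := by linarith [c.one_le_ER]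

/-- `4e² t(t+1) ≤ k²` (`6t ≤ k`, `k ≥ 60`). [cite: Ford2002, proof of Lemma 4.2
("k(8jt)²(22t²)^{2/ν} ≤ … < k^{4/ν}")] -/
theorem four_esq_t_le : 4 * Real.exp 2 * (c.t : ℝ) * (c.t + 1) ≤ (c.k : ℝ) ^ 2 := by
  have he := exp_two_le
  have ht := c.six_t_le; have hk := c.k_geR; have ht0 := c.t_pos
  have h1 : 36 * ((c.t : ℝ) * (c.t + 1)) ≤ (c.k : ℝ) * (c.k + 6) := by nlinarith
  have h2 : Real.exp 2 * ((c.t : ℝ) * (c.t + 1)) ≤ 7.39 * ((c.t : ℝ) * (c.t + 1)) :=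
    mul_le_mul_of_nonneg_right he (by positivity)
  have hk2 : 60 * (c.k : ℝ) ≤ (c.k : ℝ) ^ 2 := by nlinarith
  nlinarith

/-- `(16tj/3)² tk ≤ 0.033 k⁶` for `j ≤ L`. [folklore] -/
theorem poly_T1_le {j : ℕ} (hj : j ≤ c.L) :
    ((16 : ℝ) * ((c.t * j : ℕ) : ℝ) / 3) ^ 2 * ((c.t * c.k : ℕ) : ℝ) ≤ 0.033 * (c.k : ℝ) ^ 6 := by
  have ht := c.six_t_le; have hk := c.k_geR; have ht0 := c.t_pos; have hL := c.two_L_le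
  have hhk : (c.h : ℝ) ≤ c.k := by exact_mod_cast c.h_le_k
  have hjL : (j : ℝ) ≤ c.L := by exact_mod_cast hj
  have hj0 : (0 : ℝ) ≤ j := Nat.cast_nonneg _
  have h1 : ((c.t * j : ℕ) : ℝ) ≤ (c.k : ℝ) ^ 2 / 12 := by
    push_cast
    have : (c.t : ℝ) * j ≤ (c.k / 6) * (c.k / 2) := mul_le_mul (by linarith) (by linarith) hj0 (by linarith)
    linarith
  have h2 : ((c.t * c.k : ℕ) : ℝ) ≤ (c.k : ℝ) ^ 2 / 6 := by push_cast; nlinarith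
  have h0 : (0 : ℝ) ≤ ((c.t * j : ℕ) : ℝ) := Nat.cast_nonneg _
  calc ((16 : ℝ) * ((c.t * j : ℕ) : ℝ) / 3) ^ 2 * ((c.t * c.k : ℕ) : ℝ)
      ≤ ((16 : ℝ) * ((c.k : ℝ) ^ 2 / 12) / 3) ^ 2 * ((c.k : ℝ) ^ 2 / 6) := by gcongr
    _ = (16 / 81 / 6) * (c.k : ℝ) ^ 6 := by ring
    _ ≤ 0.033 * (c.k : ℝ) ^ 6 := by nlinarith [pow_nonneg c.k_pos.le 6]

/-- `e^{1/η} ≥ 0.033 k⁶` (indeed `1/η ≥ 3h/2 ≥ 1.25k`). [folklore] -/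
theorem poly_le_exp_inv_η : 0.033 * (c.k : ℝ) ^ 6 ≤ Real.exp (1 / c.η) := by
  refine (poly_le_exp_T1 c.k_geR).trans (Real.exp_le_exp.2 ?_)
  rw [le_div_iff₀ c.hη]
  have := c.hηh; have := c.k_le; have := c.hη; nlinarith

/-! #### The range facts for `q ∈ Qrange` -/

section Step

variable {j : ℕ} {M : ℝ}

/-- Basic facts on `[M_{j}, P_{j}]`. [folklore] -/
theorem range_facts {i : ℕ} (hi1 : 1 ≤ i) (hi : i ≤ c.L) (hM : c.Mw i ≤ M) (hMP : M ≤ c.Pw i) :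
    1 < M ∧ M ≤ c.P ∧ c.R ≤ M ∧ 0 < c.ν M ∧ c.η ≤ c.ν M ∧ c.ν M ≤ c.η₁ ∧ c.ν M ≤ 1 := by
  have h1 : 1 < M := lt_of_lt_of_le (c.one_lt_Mw i) hM
  have h2 : M ≤ c.P := hMP.trans (c.Pw_le_P i)
  have h3 : c.R ≤ M := (c.R_le_Mw i).trans hM
  exact ⟨h1, h2, h3, c.ν_pos h1, c.η_le_ν h1 h2, c.ν_le_η₁ hi1 hi hM, c.ν_le_one h1 h3⟩

/-- `(P_{j+1})^α = P_j` and `(M_{j+1})^α / R = M_j` (`j + 1 ≤ L`). [cite: Ford2002, proof of Lemma 4.2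
("By the definition of M_j and P_j, M_{j−1} ≤ M/q ≤ P_{j−1}")] -/
theorem Pw_succ_rpow_α (hj : j + 1 ≤ c.L) : c.Pw (j + 1) ^ c.α = c.Pw j := by
  unfold Pw
  rw [← Real.rpow_mul c.P_pos.le, ← pow_succ, show c.L - (j + 1) + 1 = c.L - j by omega]

/-- Auxiliary step (elementary consequence of the definitions and the standing hypotheses). [folklore] -/
theorem Mw_succ_rpow_α (hj : j + 1 ≤ c.L) : c.Mw (j + 1) ^ c.α / c.R = c.Mw j := by
  rw [c.Mw_eq, c.Mw_eq, ← Real.rpow_mul c.P_pos.le]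
  have hR1 : c.R = c.P ^ c.η := c.hR
  rw [hR1, ← Real.rpow_sub c.P_pos]
  congr 1
  have e : c.L - j = c.L - (j + 1) + 1 := by omega
  rw [e, pow_succ]
  have hα : c.α = 1 - 1 / c.h := rfl
  have := c.h_pos
  rw [hα]; field_simp; ring

/-- For `q ∈ Qrange R ⌊M^{1/h}⌋` with `M ∈ [M_{j+1}, P_{j+1}]`: `1 ≤ q`, `M^{1/h} < q ≤ M^{1/h} R`, and
`M/q ∈ [M_j, P_j]`. [cite: Ford2002, proof of Lemma 4.2 ("M_{j−1} ≤ M/q ≤ P_{j−1}")] -/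
theorem q_facts (hj : j + 1 ≤ c.L) (hM : c.Mw (j + 1) ≤ M) (hMP : M ≤ c.Pw (j + 1))
    {q : ℕ} (hq : q ∈ Qrange c.R ⌊M ^ (1 / (c.h : ℝ))⌋₊) :
    1 ≤ q ∧ M ^ (1 / (c.h : ℝ)) < q ∧ (q : ℝ) ≤ M ^ (1 / (c.h : ℝ)) * c.R ∧
      c.Mw j ≤ M / q ∧ M / q ≤ c.Pw j := by
  obtain ⟨hM1, hMP', hRM, -⟩ := c.range_facts (i := j + 1) (by omega) hj hM hMP
  have hM0 : 0 < M := by linarith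
  rw [mem_Qrange] at hq
  obtain ⟨⟨hq1, hq2⟩, -⟩ := hq
  set Q : ℝ := M ^ (1 / (c.h : ℝ)) with hQ
  have hQ0 : 0 < Q := Real.rpow_pos_of_pos hM0 _
  have hQ1 : 1 ≤ Q := Real.one_le_rpow hM1.le (by have := c.h_pos; positivity)
  have hqQ : Q < q := by
    have := Nat.lt_floor_add_one Q
    have h2 : ((⌊Q⌋₊ + 1 : ℕ) : ℝ) ≤ q := by exact_mod_cast hq1
    push_cast at h2; linarith
  have hq0 : (0 : ℝ) < q := hQ0.trans hqQ
  have hqQR : (q : ℝ) ≤ Q * c.R := by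
    calc (q : ℝ) ≤ ((⌊Q⌋₊ * ⌊c.R⌋₊ : ℕ) : ℝ) := by exact_mod_cast hq2
      _ = (⌊Q⌋₊ : ℝ) * ⌊c.R⌋₊ := by push_cast; ring
      _ ≤ Q * c.R := mul_le_mul (Nat.floor_le hQ0.le) (Nat.floor_le c.R_pos.le) (Nat.cast_nonneg _) hQ0.le
  -- `M / Q = M^α`
  have hMQ : M / Q = M ^ c.α := by
    rw [hQ, show c.α = 1 - 1 / (c.h : ℝ) from rfl, Real.rpow_sub hM0, Real.rpow_one]
  refine ⟨by exact_mod_cast (show 0 < q by exact_mod_cast hq0), hqQ, hqQR, ?_, ?_⟩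
  · -- `M/q ≥ M/(QR) = M^α/R ≥ M_{j+1}^α/R = M_j`
    rw [← c.Mw_succ_rpow_α hj]
    have h1 : c.Mw (j + 1) ^ c.α ≤ M ^ c.α := Real.rpow_le_rpow (c.Mw_pos _).le hM c.α_pos.le
    calc c.Mw (j + 1) ^ c.α / c.R ≤ M ^ c.α / c.R := div_le_div_of_nonneg_right h1 c.R_pos.le
      _ = M / (Q * c.R) := by rw [← hMQ, div_div]
      _ ≤ M / q := div_le_div_of_nonneg_left hM0.le hq0 hqQR
  · -- `M/q ≤ M/Q = M^α ≤ P_{j+1}^α = P_j`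
    rw [← c.Pw_succ_rpow_α hj]
    calc M / q ≤ M / Q := div_le_div_of_nonneg_left hM0.le hQ0 hqQ.le
      _ = M ^ c.α := hMQ
      _ ≤ c.Pw (j + 1) ^ c.α := Real.rpow_le_rpow hM0.le hMP c.α_pos.le

/-- The exponent `E = −1 + h(1−α^j)/(2j)` of the `q`-sum and its range. [cite: Ford2002, proof of
Lemma 4.2 ("−5/8 ≤ E ≤ −1/2")] -/
theorem Eq_range (hj1 : 1 ≤ j) (hj : j + 1 ≤ c.L) :
    3 / 8 ≤ c.h * (1 - c.α ^ j) / (2 * j) ∧ c.h * (1 - c.α ^ j) / (2 * j) ≤ 1 / 2 :=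
  E_range (h := c.h) (by linarith [c.h_geR]) hj1
    (by have := c.two_L_le; linarith [(show (j:ℝ) + 1 ≤ c.L by exact_mod_cast hj)])

/-- **The `q`-sum**: `S = ∑_{q} q^E ≤ (8/3) R^{1/2} M^{(1−α^j)/(2j)}`. [cite: Ford2002, proof of Lemma 4.2
("S ≤ ∫_1^{RM^{1/h}} x^E dx ≤ (RM^{1/h})^{E+1}/(E+1) ≤ (8/3)(RM^{1/h})^{E+1} ≤ e R^{1/2} M^{(1−α^{j−1})/(2j−2)}")] -/
theorem qsum_le (hj1 : 1 ≤ j) (hj : j + 1 ≤ c.L) (hM : c.Mw (j + 1) ≤ M) (hMP : M ≤ c.Pw (j + 1)) :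
    ∑ q ∈ Qrange c.R ⌊M ^ (1 / (c.h : ℝ))⌋₊, (q : ℝ) ^ (-1 + c.h * (1 - c.α ^ j) / (2 * j))
      ≤ 8 / 3 * c.R ^ (1 / 2 : ℝ) * M ^ ((1 - c.α ^ j) / (2 * j)) := by
  obtain ⟨hM1, -, -, -⟩ := c.range_facts (i := j + 1) (by omega) hj hM hMP
  have hM0 : 0 < M := by linarith
  obtain ⟨hE1, hE2⟩ := c.Eq_range hj1 hj
  set E : ℝ := -1 + c.h * (1 - c.α ^ j) / (2 * j) with hE
  set Q : ℝ := M ^ (1 / (c.h : ℝ)) with hQ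
  set Qn : ℕ := ⌊Q⌋₊ with hQn
  have hQ0 : 0 < Q := Real.rpow_pos_of_pos hM0 _
  have hQ1 : 1 ≤ Q := Real.one_le_rpow hM1.le (by have := c.h_pos; positivity)
  have hQn1 : 1 ≤ Qn := Nat.le_floor (by simpa using hQ1)
  have hfl := c.one_le_floor_R
  -- compare with the full interval
  have h1 : ∑ q ∈ Qrange c.R Qn, (q : ℝ) ^ E ≤ ∑ q ∈ Finset.Ioc Qn (Qn * ⌊c.R⌋₊), (q : ℝ) ^ E := by
    refine Finset.sum_le_sum_of_subset_of_nonneg (fun q hq => ?_) fun q _ _ => Real.rpow_nonneg (Nat.cast_nonneg _) _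
    rw [mem_Qrange] at hq; rw [Finset.mem_Ioc]; exact hq.1
  have hab : Qn ≤ Qn * ⌊c.R⌋₊ := Nat.le_mul_of_pos_right Qn hfl
  have h2 := sum_Ioc_rpow_le hQn1 hab (E := E) (by linarith) (by linarith)
  refine h1.trans (h2.trans ?_)
  have hE0 : 0 < E + 1 := by linarith
  -- `(Qn ⌊R⌋)^{E+1} ≤ (Q R)^{E+1} = Q^{E+1} R^{E+1} ≤ M^{(E+1)/h} R^{1/2}`
  have h3 : (((Qn * ⌊c.R⌋₊ : ℕ)) : ℝ) ^ (E + 1) ≤ (Q * c.R) ^ (E + 1) := by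
    refine Real.rpow_le_rpow (Nat.cast_nonneg _) ?_ hE0.le
    push_cast
    exact mul_le_mul (Nat.floor_le hQ0.le) (Nat.floor_le c.R_pos.le) (Nat.cast_nonneg _) hQ0.le
  have h4 : (Q * c.R) ^ (E + 1) ≤ M ^ ((1 - c.α ^ j) / (2 * j)) * c.R ^ (1 / 2 : ℝ) := by
    rw [Real.mul_rpow hQ0.le c.R_pos.le, hQ, ← Real.rpow_mul hM0.le]
    refine mul_le_mul (le_of_eq ?_) (Real.rpow_le_rpow_of_exponent_le c.one_lt_R.le (by linarith)) (Real.rpow_nonneg c.R_pos.le _) (Real.rpow_nonneg hM0.le _)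
    congr 1; rw [hE]; have := c.h_pos; field_simp; ring
  have h5 : 1 / (E + 1) ≤ 8 / 3 := by rw [div_le_iff₀ hE0]; linarith
  calc (((Qn * ⌊c.R⌋₊ : ℕ)) : ℝ) ^ (E + 1) / (E + 1) = (1 / (E + 1)) * (((Qn * ⌊c.R⌋₊ : ℕ)) : ℝ) ^ (E + 1) := by ring
    _ ≤ (8 / 3) * (M ^ ((1 - c.α ^ j) / (2 * j)) * c.R ^ (1 / 2 : ℝ)) :=
        mul_le_mul h5 (h3.trans h4) (Real.rpow_nonneg (Nat.cast_nonneg _) _) (by norm_num)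
    _ = _ := by ring

end Step


/-! #### `C_j`, `X_j`, `E_j` -/

/-- Auxiliary step (elementary consequence of the definitions and the standing hypotheses). [folklore] -/
theorem Cseq_one : c.Cseq 1 = ((c.t * c.k : ℕ) : ℝ) ^ c.t := rfl
/-- Auxiliary step (elementary consequence of the definitions and the standing hypotheses). [folklore] -/
theorem Cseq_succ_succ (j : ℕ) : c.Cseq (j + 2) = max (c.Cseq (j + 1)) (Real.exp (c.t * c.E (j + 2))) := rfl
/-- Auxiliary step (elementary consequence of the definitions and the standing hypotheses). [folklore] -/
theorem tk_ge_one : (1 : ℝ) ≤ ((c.t * c.k : ℕ) : ℝ) := by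
  have : 1 ≤ c.t * c.k := Nat.one_le_iff_ne_zero.2 (Nat.mul_ne_zero (by have := c.ht1; omega) (by have := c.hk; omega))
  exact_mod_cast this
/-- Auxiliary step (elementary consequence of the definitions and the standing hypotheses). [folklore] -/
theorem Cseq_pos : ∀ j : ℕ, 0 < c.Cseq j
  | 0 => by show 0 < ((c.t * c.k : ℕ) : ℝ) ^ c.t; have := c.tk_ge_one; positivity
  | 1 => by rw [c.Cseq_one]; have := c.tk_ge_one; positivity
  | j + 2 => by rw [c.Cseq_succ_succ]; exact lt_max_of_lt_right (Real.exp_pos _)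
/-- Auxiliary step (elementary consequence of the definitions and the standing hypotheses). [folklore] -/
theorem Cseq_mono {j : ℕ} (hj : 1 ≤ j) : c.Cseq j ≤ c.Cseq (j + 1) := by
  obtain ⟨i, rfl⟩ : ∃ i, j = i + 1 := ⟨j - 1, by omega⟩
  rw [show i + 1 + 1 = i + 2 by ring, c.Cseq_succ_succ]; exact le_max_left _ _
/-- Auxiliary step (elementary consequence of the definitions and the standing hypotheses). [folklore] -/
theorem exp_le_Cseq {j : ℕ} (hj : 2 ≤ j) : Real.exp (c.t * c.E j) ≤ c.Cseq j := by
  obtain ⟨i, rfl⟩ : ∃ i, j = i + 2 := ⟨j - 2, by omega⟩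
  rw [c.Cseq_succ_succ]; exact le_max_right _ _

/-- Auxiliary step (elementary consequence of the definitions and the standing hypotheses). [folklore] -/
theorem hα_eq : (c.h : ℝ) * c.α = c.h - 1 := by have := c.h_mul_one_sub_α; linarith
/-- Auxiliary step (elementary consequence of the definitions and the standing hypotheses). [folklore] -/
theorem X_one : c.X 1 = c.t := by unfold X; rw [pow_one]; have := c.h_mul_one_sub_α; push_cast; nlinarith
/-- `X_{j+1} = t + X_j + t(1 − α^j)`. [cite: Ford2002, proof of Lemma 4.2 (the exponent bookkeeping
`2t(j−1) − (t/2)(h+k) + Δ_{j−1} + t + t(1−α^{j−1}) = 2tj − (t/2)(h+k) + Δ_j`)] -/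
theorem X_succ (j : ℕ) : c.X (j + 1) = c.t + c.X j + c.t * (1 - c.α ^ j) := by
  unfold X; rw [pow_succ]; have := c.hα_eq; push_cast
  linear_combination (c.t : ℝ) * c.α ^ j * this
/-- `X_{j+1} − t f_{j+1} = (1 + 1/h) t j + t`. [cite: Ford2002, proof of Lemma 4.2 ("M^{tj + t(j−1)/h} = M^{2tj−…+Δ_j} M^{−tf_j}")] -/
theorem X_succ_sub (j : ℕ) : c.X (j + 1) - c.t * fj c.h (j + 1) = (1 + 1 / c.h) * (c.t * j) + c.t := by
  unfold X fj
  have hα : c.α = 1 - 1 / c.h := rfl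
  rw [← hα]; push_cast
  have := c.h_pos
  field_simp
  ring

/-! #### The induction -/

section Induction

variable {j : ℕ} {M : ℝ}

/-- `0 ∉ 𝒞(M,R)` (as integers). [folklore] -/
theorem zero_not_mem_C (M : ℝ) : (0 : ℤ) ∉ (smoothSet M c.R).map Nat.castEmbedding := by
  intro h0
  rw [Finset.mem_map] at h0
  obtain ⟨n, hn, hn0⟩ := h0
  have := (mem_smoothSet.1 hn).1
  simp at hn0; omega

/-- **Base case `j = 1`**: `H_1(M) = J_{t,k,h}(𝒞(M,R)) ≤ (tk)^t |𝒞|^t ≤ (tk)^t M^t K₁^t`.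
[cite: Ford2002, proof of Lemma 4.2 ("H_1(M) ≤ k^t|𝒞(M,R)|^t … so (4.13) holds for j = 1")] -/
theorem claim_one : c.Claim 1 := by
  intro M hM hMP
  obtain ⟨hM1, hMP', hRM, hν0, -, hνη₁, -⟩ := c.range_facts (i := 1) le_rfl c.hL1 hM hMP
  have hM0 : 0 < M := by linarith
  set B : Finset ℤ := (smoothSet M c.R).map Nat.castEmbedding with hB
  have hdiag := Jinc_diag_le (k := c.k) c.one_le_h c.hkt B (c.zero_not_mem_C M)
  have hcard : B.card = (smoothSet M c.R).card := card_map _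
  have hC := c.card_C_le hRM hM1 hMP'
  have hcν := c.cν_le_K₁ hM1 hνη₁
  have hK := c.K₁_pos
  have hCK : ((smoothSet M c.R).card : ℝ) ≤ M * c.K₁ := hC.trans (mul_le_mul_of_nonneg_left hcν hM0.le)
  unfold H
  have hc : Nat.choose 1 2 = 0 := by decide
  rw [mul_one, c.X_one, Real.rpow_natCast, c.Cseq_one, hc, mul_zero, pow_zero, mul_one]
  calc (Jinc c.k c.t B c.h c.k : ℝ) ≤ (((c.t * c.k) ^ c.t * B.card ^ c.t : ℕ) : ℝ) := by exact_mod_cast hdiag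
    _ = ((c.t * c.k : ℕ) : ℝ) ^ c.t * ((smoothSet M c.R).card : ℝ) ^ c.t := by rw [hcard]; push_cast; ring
    _ ≤ ((c.t * c.k : ℕ) : ℝ) ^ c.t * (M * c.K₁) ^ c.t := by
        refine mul_le_mul_of_nonneg_left (pow_le_pow_left₀ (Nat.cast_nonneg _) hCK _) (by positivity)
    _ = c.K₁ ^ c.t * ((c.t * c.k : ℕ) : ℝ) ^ c.t * M ^ c.t := by rw [mul_pow]; ring

/-- **The prefactor of `T₂`**: `(8/3)(k^t)^{N₁} |𝒞(M,R)|^t ≤ M^t K₁^t`. [cite: Ford2002, proof of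
Lemma 4.2 ("4k^{2t(1/(hν)+1)}|𝒞(M,R)|^t ≤ M^t (10η)^{t/η₁}")] -/
theorem prefactor_le (hj : j + 1 ≤ c.L) (hM : c.Mw (j + 1) ≤ M) (hMP : M ≤ c.Pw (j + 1)) :
    (8 / 3 : ℝ) * ((c.k : ℝ) ^ c.t) ^ ⌊2 / ((c.h : ℝ) * c.ν M) + 2⌋₊ * ((smoothSet M c.R).card : ℝ) ^ c.t
      ≤ M ^ c.t * c.K₁ ^ c.t := by
  obtain ⟨hM1, hMP', hRM, hν0, -, hνη₁, -⟩ := c.range_facts (i := j + 1) (by omega) hj hM hMP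
  have hM0 : 0 < M := by linarith
  set ν := c.ν M with hν
  have hC := c.card_C_le hRM hM1 hMP'
  have hk1 : (1 : ℝ) ≤ c.k := by linarith [c.k_geR]
  have h0 : 0 ≤ 2 / ((c.h : ℝ) * ν) + 2 := by have := c.h_pos; positivity
  -- `(k^t)^{N₁} ≤ k^{t(2/(hν)+2)}`
  have h1 : ((c.k : ℝ) ^ c.t) ^ ⌊2 / ((c.h : ℝ) * ν) + 2⌋₊ ≤ (c.k : ℝ) ^ ((c.t : ℝ) * (2 / ((c.h : ℝ) * ν) + 2)) := by
    rw [← pow_mul, ← Real.rpow_natCast]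
    refine Real.rpow_le_rpow_of_exponent_le hk1 ?_
    push_cast
    exact mul_le_mul_of_nonneg_left (Nat.floor_le h0) c.t_pos.le
  -- `|𝒞|^t ≤ M^t (2.2ν)^{t/ν}`
  have h2 : ((smoothSet M c.R).card : ℝ) ^ c.t ≤ M ^ c.t * (2.2 * ν) ^ ((c.t : ℝ) / ν) := by
    calc ((smoothSet M c.R).card : ℝ) ^ c.t ≤ (M * (2.2 * ν) ^ (1 / ν)) ^ c.t := pow_le_pow_left₀ (Nat.cast_nonneg _) hC _
      _ = M ^ c.t * (2.2 * ν) ^ ((c.t : ℝ) / ν) := by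
          rw [mul_pow, ← Real.rpow_natCast ((2.2 * ν) ^ (1 / ν)) c.t, ← Real.rpow_mul (by positivity)]
          congr 2; field_simp
  have habs := absorb_T2 (k := c.k) (h := c.h) (t := c.t) (η := c.η) (ν := ν) (η₁ := c.η₁)
    c.hk c.hkt c.ht6 c.ht1 c.hη hν0 hνη₁ c.η₁_le c.hηh
  have hK : (12 * c.η) ^ ((c.t : ℝ) / c.η₁) = c.K₁ ^ c.t := by
    unfold K₁; rw [← Real.rpow_natCast, ← Real.rpow_mul (by have := c.hη; positivity)]; congr 1; field_simp
  rw [hK] at habs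
  have hMt : 0 ≤ M ^ c.t := by positivity
  calc (8 / 3 : ℝ) * ((c.k : ℝ) ^ c.t) ^ ⌊2 / ((c.h : ℝ) * ν) + 2⌋₊ * ((smoothSet M c.R).card : ℝ) ^ c.t
      ≤ (8 / 3 : ℝ) * (c.k : ℝ) ^ ((c.t : ℝ) * (2 / ((c.h : ℝ) * ν) + 2)) * (M ^ c.t * (2.2 * ν) ^ ((c.t : ℝ) / ν)) := by
        gcongr
    _ = M ^ c.t * ((8 / 3 : ℝ) * (c.k : ℝ) ^ ((c.t : ℝ) * (2 / ((c.h : ℝ) * ν) + 2)) * (2.2 * ν) ^ ((c.t : ℝ) / ν)) := by ring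
    _ ≤ M ^ c.t * c.K₁ ^ c.t := mul_le_mul_of_nonneg_left habs hMt

/-- **The sum over `q`** raised to the power `2tj`: by the induction hypothesis and the `q`-sum,
`(∑_q H_j(M/q)^{1/2tj})^{2tj} ≤ K_j M^{X_j} (8/3)^{2tj} R^{tj} M^{t(1−α^j)}`. [cite: Ford2002, proof of
Lemma 4.2 (the display with `S^{2t(j−1)}`)] -/
theorem sum_pow_le (hj1 : 1 ≤ j) (hj : j + 1 ≤ c.L) (ih : c.Claim j) (hM : c.Mw (j + 1) ≤ M) (hMP : M ≤ c.Pw (j + 1))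
    {m' : ℕ} (hm' : c.t * j = m' + 1) :
    (∑ q ∈ Qrange c.R ⌊M ^ (1 / (c.h : ℝ))⌋₊,
        (Jinc c.k (m' + 1) (Bq M c.R q) c.h c.k : ℝ) ^ (1 / (2 * ((m' : ℝ) + 1)))) ^ (2 * (m' + 1))
      ≤ (c.K₁ ^ (c.t * j) * c.Cseq j * (Real.exp 2 * c.R) ^ (c.t * j.choose 2)) * M ^ c.X j *
        ((8 / 3 : ℝ) ^ (2 * (c.t * j)) * c.R ^ (c.t * j) * M ^ ((c.t : ℝ) * (1 - c.α ^ j))) := by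
  obtain ⟨hM1, -, -, -⟩ := c.range_facts (i := j + 1) (by omega) hj hM hMP
  have hM0 : 0 < M := by linarith
  have hj0 : (0 : ℝ) < j := by exact_mod_cast hj1
  have ht0 := c.t_pos
  set Kj : ℝ := c.K₁ ^ (c.t * j) * c.Cseq j * (Real.exp 2 * c.R) ^ (c.t * j.choose 2) with hKj
  have hKj0 : 0 ≤ Kj := by have := c.K₁_pos; have := c.Cseq_pos j; have := c.ER_pos; positivity
  set n : ℕ := 2 * (m' + 1) with hn
  have hn0 : n ≠ 0 := by omega
  have hmR : ((m' : ℝ) + 1) = c.t * j := by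
    have := congrArg (Nat.cast : ℕ → ℝ) hm'; push_cast at this; linarith
  have hnR : (n : ℝ) = 2 * c.t * j := by rw [hn]; push_cast; rw [hmR]; ring
  set e : ℝ := 1 / (2 * ((m' : ℝ) + 1)) with he
  have heq : e = (n : ℝ)⁻¹ := by rw [he, hn]; push_cast; rw [one_div]
  have he0 : 0 ≤ e := by rw [he]; positivity
  have heX : c.X j * e = 1 - c.h * (1 - c.α ^ j) / (2 * j) := by
    rw [heq, hnR]; unfold X; field_simp
  set E : ℝ := -1 + c.h * (1 - c.α ^ j) / (2 * j) with hE
  -- termwise bound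
  have hterm : ∀ q ∈ Qrange c.R ⌊M ^ (1 / (c.h : ℝ))⌋₊,
      (Jinc c.k (m' + 1) (Bq M c.R q) c.h c.k : ℝ) ^ e ≤ Kj ^ e * M ^ (c.X j * e) * (q : ℝ) ^ E := by
    intro q hq
    obtain ⟨hq1, -, -, hlo, hhi⟩ := c.q_facts hj hM hMP hq
    have hq0 : (0 : ℝ) < q := by exact_mod_cast hq1
    have hih : (Jinc c.k (m' + 1) (Bq M c.R q) c.h c.k : ℝ) ≤ Kj * (M / q) ^ c.X j := by
      have := ih (M / q) hlo hhi
      unfold H at this; rw [← hKj, hm'] at this; exact this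
    calc (Jinc c.k (m' + 1) (Bq M c.R q) c.h c.k : ℝ) ^ e ≤ (Kj * (M / q) ^ c.X j) ^ e :=
          Real.rpow_le_rpow (Nat.cast_nonneg _) hih he0
      _ = Kj ^ e * (M ^ (c.X j * e) / (q : ℝ) ^ (c.X j * e)) := by
          rw [Real.mul_rpow hKj0 (Real.rpow_nonneg (by positivity) _), ← Real.rpow_mul (by positivity),
            Real.div_rpow hM0.le hq0.le]
      _ = Kj ^ e * M ^ (c.X j * e) * (q : ℝ) ^ E := by
          rw [div_eq_mul_inv, ← Real.rpow_neg hq0.le, heX, hE]; ring_nf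
  -- sum
  have hsum : ∑ q ∈ Qrange c.R ⌊M ^ (1 / (c.h : ℝ))⌋₊, (Jinc c.k (m' + 1) (Bq M c.R q) c.h c.k : ℝ) ^ e
      ≤ Kj ^ e * M ^ (c.X j * e) * ∑ q ∈ Qrange c.R ⌊M ^ (1 / (c.h : ℝ))⌋₊, (q : ℝ) ^ E := by
    rw [Finset.mul_sum]; exact Finset.sum_le_sum hterm
  have hS := c.qsum_le hj1 hj hM hMP
  rw [← hE] at hS
  have hS0 : 0 ≤ ∑ q ∈ Qrange c.R ⌊M ^ (1 / (c.h : ℝ))⌋₊, (q : ℝ) ^ E :=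
    Finset.sum_nonneg fun q _ => Real.rpow_nonneg (Nat.cast_nonneg _) _
  have hsum0 : 0 ≤ ∑ q ∈ Qrange c.R ⌊M ^ (1 / (c.h : ℝ))⌋₊, (Jinc c.k (m' + 1) (Bq M c.R q) c.h c.k : ℝ) ^ e :=
    Finset.sum_nonneg fun q _ => Real.rpow_nonneg (Nat.cast_nonneg _) _
  -- raise to the power `n = 2tj`
  have hpow : (∑ q ∈ Qrange c.R ⌊M ^ (1 / (c.h : ℝ))⌋₊, (Jinc c.k (m' + 1) (Bq M c.R q) c.h c.k : ℝ) ^ e) ^ n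
      ≤ (Kj ^ e * M ^ (c.X j * e) * (8 / 3 * c.R ^ (1 / 2 : ℝ) * M ^ ((1 - c.α ^ j) / (2 * j)))) ^ n := by
    refine pow_le_pow_left₀ hsum0 (hsum.trans ?_) n
    exact mul_le_mul_of_nonneg_left hS (by positivity)
  refine hpow.trans (le_of_eq ?_)
  -- evaluate the `n`-th powers
  have e1 : (Kj ^ e) ^ n = Kj := by rw [heq, Real.rpow_inv_natCast_pow hKj0 hn0]
  have e2 : (M ^ (c.X j * e)) ^ n = M ^ c.X j := by
    rw [← Real.rpow_natCast, ← Real.rpow_mul hM0.le, heq, mul_assoc, inv_mul_cancel₀ (by exact_mod_cast hn0), mul_one]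
  have e3 : (c.R ^ (1 / 2 : ℝ)) ^ n = c.R ^ (c.t * j) := by
    rw [← Real.rpow_natCast, ← Real.rpow_mul c.R_pos.le, hnR, ← Real.rpow_natCast]; congr 1; push_cast; ring
  have e4 : (M ^ ((1 - c.α ^ j) / (2 * j))) ^ n = M ^ ((c.t : ℝ) * (1 - c.α ^ j)) := by
    rw [← Real.rpow_natCast, ← Real.rpow_mul hM0.le, hnR]; congr 1; field_simp
  have e5 : n = 2 * (c.t * j) := by omega
  rw [mul_pow, mul_pow, mul_pow, mul_pow, e1, e2, e3, e4, e5]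

/-- **The branch `T₂`.** [cite: Ford2002, proof of Lemma 4.2 (second term of the max)] -/
theorem T2_le (hj1 : 1 ≤ j) (hj : j + 1 ≤ c.L) (ih : c.Claim j) (hM : c.Mw (j + 1) ≤ M) (hMP : M ≤ c.Pw (j + 1))
    {m' : ℕ} (hm' : c.t * j = m' + 1) :
    (8 / 3 : ℝ) * ((c.k : ℝ) ^ c.t) ^ ⌊2 / ((c.h : ℝ) * c.ν M) + 2⌋₊ * ((smoothSet M c.R).card : ℝ) ^ c.t *
        (∑ q ∈ Qrange c.R ⌊M ^ (1 / (c.h : ℝ))⌋₊,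
          (Jinc c.k (m' + 1) (Bq M c.R q) c.h c.k : ℝ) ^ (1 / (2 * ((m' : ℝ) + 1)))) ^ (2 * (m' + 1))
      ≤ c.K₁ ^ (c.t * (j + 1)) * c.Cseq (j + 1) * (Real.exp 2 * c.R) ^ (c.t * (j + 1).choose 2) * M ^ c.X (j + 1) := by
  obtain ⟨hM1, -, -, -⟩ := c.range_facts (i := j + 1) (by omega) hj hM hMP
  have hM0 : 0 < M := by linarith
  have h1 := c.prefactor_le hj hM hMP
  have h2 := c.sum_pow_le hj1 hj ih hM hMP hm'
  have hK := c.K₁_pos; have hCs := c.Cseq_pos j; have hCs1 := c.Cseq_pos (j + 1); have hER := c.ER_pos; have hR := c.R_pos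
  have hsum0 : 0 ≤ (∑ q ∈ Qrange c.R ⌊M ^ (1 / (c.h : ℝ))⌋₊,
      (Jinc c.k (m' + 1) (Bq M c.R q) c.h c.k : ℝ) ^ (1 / (2 * ((m' : ℝ) + 1)))) ^ (2 * (m' + 1)) :=
    pow_nonneg (Finset.sum_nonneg fun q _ => Real.rpow_nonneg (Nat.cast_nonneg _) _) _
  -- `(8/3)^{2tj} R^{tj} ≤ (e² R)^{tj}`
  have h3 : (8 / 3 : ℝ) ^ (2 * (c.t * j)) * c.R ^ (c.t * j) ≤ (Real.exp 2 * c.R) ^ (c.t * j) := by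
    rw [pow_mul, mul_pow]
    exact mul_le_mul_of_nonneg_right (pow_le_pow_left₀ (by positivity) sq_83_le_exp_two _) (by positivity)
  -- `C_j ≤ C_{j+1}`
  have h4 := c.Cseq_mono hj1
  -- exponents
  have h5 : (Real.exp 2 * c.R) ^ (c.t * j.choose 2) * (Real.exp 2 * c.R) ^ (c.t * j) = (Real.exp 2 * c.R) ^ (c.t * (j + 1).choose 2) := by
    rw [← pow_add, ← mul_add, Nat.choose_succ_succ', Nat.choose_one_right, add_comm j]
  have h6 : M ^ c.t * M ^ c.X j * M ^ ((c.t : ℝ) * (1 - c.α ^ j)) = M ^ c.X (j + 1) := by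
    rw [← Real.rpow_natCast, ← Real.rpow_add hM0, ← Real.rpow_add hM0, c.X_succ]
  calc _ ≤ (M ^ c.t * c.K₁ ^ c.t) * ((c.K₁ ^ (c.t * j) * c.Cseq j * (Real.exp 2 * c.R) ^ (c.t * j.choose 2)) * M ^ c.X j *
        ((8 / 3 : ℝ) ^ (2 * (c.t * j)) * c.R ^ (c.t * j) * M ^ ((c.t : ℝ) * (1 - c.α ^ j)))) :=
        mul_le_mul h1 h2 hsum0 (by positivity)
    _ = c.K₁ ^ (c.t * (j + 1)) * c.Cseq j * ((Real.exp 2 * c.R) ^ (c.t * j.choose 2) * ((8 / 3 : ℝ) ^ (2 * (c.t * j)) * c.R ^ (c.t * j)))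
        * (M ^ c.t * M ^ c.X j * M ^ ((c.t : ℝ) * (1 - c.α ^ j))) := by rw [mul_add, mul_one, pow_add]; ring
    _ ≤ c.K₁ ^ (c.t * (j + 1)) * c.Cseq (j + 1) * ((Real.exp 2 * c.R) ^ (c.t * j.choose 2) * (Real.exp 2 * c.R) ^ (c.t * j))
        * (M ^ c.t * M ^ c.X j * M ^ ((c.t : ℝ) * (1 - c.α ^ j))) := by
        refine mul_le_mul_of_nonneg_right ?_
          (mul_nonneg (mul_nonneg (pow_nonneg hM0.le _) (Real.rpow_nonneg hM0.le _)) (Real.rpow_nonneg hM0.le _))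
        refine mul_le_mul (mul_le_mul_of_nonneg_left h4 (by positivity)) (mul_le_mul_of_nonneg_left h3 (by positivity))
          (by positivity) (by positivity)
    _ = _ := by rw [h5, h6]

/-- **The constant of the branch `T₁`**: `B₀ · tk ≤ k^{4/ν}`, where
`B₀ = (16tj/3)² 4^{N₀}(t(t+1))^{N₀} e^{1/ν}`. [cite: Ford2002, proof of Lemma 4.2
("k(8jt)²(22t²)^{2/ν} ≤ (k^{3/h}22t²)^{2/ν} < (27t²)^{2/ν} < k^{4/ν}")] -/
theorem B0_tk_le (hj1 : 1 ≤ j) (hj : j + 1 ≤ c.L) (hM : c.Mw (j + 1) ≤ M) (hMP : M ≤ c.Pw (j + 1))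
    {m' : ℕ} (hm' : c.t * j = m' + 1) :
    ((16 : ℝ) * (m' + 1) / 3) ^ 2 * (4 : ℝ) ^ ⌊2 / c.ν M⌋₊ * ((c.t : ℝ) * (c.t + 1)) ^ ⌊2 / c.ν M⌋₊
        * Real.exp (1 / c.ν M) * ((c.t * c.k : ℕ) : ℝ) ≤ (c.k : ℝ) ^ (4 / c.ν M) := by
  obtain ⟨hM1, -, -, hν0, -, hνη₁, -⟩ := c.range_facts (i := j + 1) (by omega) hj hM hMP
  set ν := c.ν M with hν
  have ht0 := c.t_pos; have hk0 := c.k_pos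
  have hmR : ((m' : ℝ) + 1) = ((c.t * j : ℕ) : ℝ) := by
    have := congrArg (Nat.cast : ℕ → ℝ) hm'; push_cast at this ⊢; linarith
  -- the polynomial part
  have hpoly : ((16 : ℝ) * (m' + 1) / 3) ^ 2 * ((c.t * c.k : ℕ) : ℝ) ≤ Real.exp (1 / c.η) := by
    rw [hmR]; exact (c.poly_T1_le (by omega : j ≤ c.L)).trans c.poly_le_exp_inv_η
  have hexp3 : Real.exp (1 / c.η) ≤ Real.exp (3 / ν) := by
    rw [Real.exp_le_exp, div_le_div_iff₀ c.hη hν0]; have := c.η₁_le; nlinarith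
  -- the `N₀`-powers
  set x : ℝ := 4 * ((c.t : ℝ) * (c.t + 1)) with hx
  have hx1 : 1 ≤ x := by rw [hx]; nlinarith [c.one_le_tR]
  have h2ν : 0 ≤ 2 / ν := by positivity
  have hN : (4 : ℝ) ^ ⌊2 / ν⌋₊ * ((c.t : ℝ) * (c.t + 1)) ^ ⌊2 / ν⌋₊ ≤ x ^ (2 / ν) := by
    rw [← mul_pow, ← hx, ← Real.rpow_natCast]
    exact Real.rpow_le_rpow_of_exponent_le hx1 (Nat.floor_le h2ν)
  -- `x^{2/ν} e^{1/ν} = (x e^{1/2})^{2/ν} ≤ (k² e^{-3/2})^{2/ν} = k^{4/ν} e^{-3/ν}`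
  have hbase : x * Real.exp (1 / 2) ≤ (c.k : ℝ) ^ 2 * Real.exp (-(3 / 2)) := by
    have h4 := c.four_esq_t_le
    have e2 : Real.exp 2 = Real.exp (1 / 2) * Real.exp (3 / 2) := by rw [← Real.exp_add]; norm_num
    have e3 : Real.exp (3 / 2) * Real.exp (-(3 / 2)) = 1 := by rw [← Real.exp_add]; norm_num
    have hpos := Real.exp_pos (-(3 / 2 : ℝ))
    calc x * Real.exp (1 / 2) = (4 * Real.exp 2 * c.t * (c.t + 1)) * Real.exp (-(3 / 2)) := by
          rw [hx, e2]; linear_combination (-(4 : ℝ)) * Real.exp (1/2) * c.t * (c.t + 1) * e3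
      _ ≤ (c.k : ℝ) ^ 2 * Real.exp (-(3 / 2)) := mul_le_mul_of_nonneg_right h4 hpos.le
  have hmain : x ^ (2 / ν) * Real.exp (1 / ν) ≤ (c.k : ℝ) ^ (4 / ν) * Real.exp (-(3 / ν)) := by
    have e1 : Real.exp (1 / ν) = Real.exp (1 / 2) ^ (2 / ν) := by rw [← Real.exp_mul]; congr 1; field_simp
    have e4 : Real.exp (-(3 / ν)) = Real.exp (-(3 / 2)) ^ (2 / ν) := by rw [← Real.exp_mul]; congr 1; field_simp
    have e5 : (c.k : ℝ) ^ (4 / ν) = ((c.k : ℝ) ^ 2) ^ (2 / ν) := by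
      rw [← Real.rpow_natCast, ← Real.rpow_mul hk0.le]; congr 1; push_cast; field_simp; ring
    rw [e1, e4, e5, ← Real.mul_rpow (by linarith) (Real.exp_pos _).le, ← Real.mul_rpow (by positivity) (Real.exp_pos _).le]
    exact Real.rpow_le_rpow (by positivity) hbase h2ν
  -- assemble
  have hfin : Real.exp (1 / c.η) * Real.exp (-(3 / ν)) ≤ 1 := by
    calc Real.exp (1 / c.η) * Real.exp (-(3 / ν)) ≤ Real.exp (3 / ν) * Real.exp (-(3 / ν)) :=
          mul_le_mul_of_nonneg_right hexp3 (Real.exp_pos _).le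
      _ = 1 := by rw [← Real.exp_add]; norm_num
  have hk4 : 0 ≤ (c.k : ℝ) ^ (4 / ν) := Real.rpow_nonneg hk0.le _
  calc ((16 : ℝ) * (m' + 1) / 3) ^ 2 * (4 : ℝ) ^ ⌊2 / ν⌋₊ * ((c.t : ℝ) * (c.t + 1)) ^ ⌊2 / ν⌋₊
        * Real.exp (1 / ν) * ((c.t * c.k : ℕ) : ℝ)
      = (((16 : ℝ) * (m' + 1) / 3) ^ 2 * ((c.t * c.k : ℕ) : ℝ)) * ((4 : ℝ) ^ ⌊2 / ν⌋₊ * ((c.t : ℝ) * (c.t + 1)) ^ ⌊2 / ν⌋₊ * Real.exp (1 / ν)) := by ring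
    _ ≤ Real.exp (1 / c.η) * (x ^ (2 / ν) * Real.exp (1 / ν)) := by
        refine mul_le_mul hpoly (mul_le_mul_of_nonneg_right hN (Real.exp_pos _).le) (by positivity) (Real.exp_pos _).le
    _ ≤ Real.exp (1 / c.η) * ((c.k : ℝ) ^ (4 / ν) * Real.exp (-(3 / ν))) := mul_le_mul_of_nonneg_left hmain (Real.exp_pos _).le
    _ = (c.k : ℝ) ^ (4 / ν) * (Real.exp (1 / c.η) * Real.exp (-(3 / ν))) := by ring
    _ ≤ (c.k : ℝ) ^ (4 / ν) * 1 := mul_le_mul_of_nonneg_left hfin hk4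
    _ = _ := mul_one _

set_option maxHeartbeats 400000 in
/-- **The branch `T₁`.** [cite: Ford2002, proof of Lemma 4.2 (first term of the max, and
"M^{−tf_j} ≤ R^{thf_j}P^{−tf_jα^{L−j}} ≤ R^{(t/2)(j²−j)} P^{−tf_jα^{L−j}}", "we conclude that
H_j(M) ≤ … max[e^{tE_j}, C_{j−1}]")] -/
theorem T1_le (hj1 : 1 ≤ j) (hj : j + 1 ≤ c.L) (hM : c.Mw (j + 1) ≤ M) (hMP : M ≤ c.Pw (j + 1))
    {m' : ℕ} (hm' : c.t * j = m' + 1) {B₀ C : ℝ} (hB₀0 : 0 ≤ B₀) (hC0 : 0 ≤ C) (hCK : C ≤ M * c.K₁)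
    (hB : B₀ * ((c.t * c.k : ℕ) : ℝ) ≤ (c.k : ℝ) ^ (4 / c.ν M)) :
    (B₀ * M ^ (1 / (c.h : ℝ)) * C) ^ (m' + 1) * ((c.t * c.k : ℕ) : ℝ) ^ c.t * C ^ c.t
      ≤ c.K₁ ^ (c.t * (j + 1)) * c.Cseq (j + 1) * (Real.exp 2 * c.R) ^ (c.t * (j + 1).choose 2) * M ^ c.X (j + 1) := by
  obtain ⟨hM1, hMP', hRM, hν0, hην, hνη₁, -⟩ := c.range_facts (i := j + 1) (by omega) hj hM hMP
  have hM0 : 0 < M := by linarith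
  have ht0 := c.t_pos; have hk0 := c.k_pos; have hK := c.K₁_pos; have hER := c.ER_pos
  have hTK1 : 1 ≤ ((c.t * c.k : ℕ) : ℝ) := c.tk_ge_one
  have htj : m' + 1 = c.t * j := hm'.symm
  -- Step 1: replace `C` by `M K₁`
  have hMK : 0 ≤ M * c.K₁ := by positivity
  have step1 : (B₀ * M ^ (1 / (c.h : ℝ)) * C) ^ (m' + 1) * ((c.t * c.k : ℕ) : ℝ) ^ c.t * C ^ c.t
      ≤ (B₀ * M ^ (1 / (c.h : ℝ)) * (M * c.K₁)) ^ (m' + 1) * ((c.t * c.k : ℕ) : ℝ) ^ c.t * (M * c.K₁) ^ c.t := by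
    gcongr
  refine step1.trans ?_
  rw [htj]
  -- Step 2: regroup
  have step2 : (B₀ * M ^ (1 / (c.h : ℝ)) * (M * c.K₁)) ^ (c.t * j) * ((c.t * c.k : ℕ) : ℝ) ^ c.t * (M * c.K₁) ^ c.t
      = (B₀ ^ (c.t * j) * ((c.t * c.k : ℕ) : ℝ) ^ c.t) * c.K₁ ^ (c.t * (j + 1)) * ((M ^ (1 / (c.h : ℝ)) * M) ^ (c.t * j) * M ^ c.t) := by
    rw [mul_add, mul_one, pow_add]; simp only [mul_pow]; ring
  rw [step2]
  -- Step 3: `B₀^{tj} TK^t ≤ (k^{4/ν})^{tj}`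
  set ν := c.ν M with hν
  have step3 : B₀ ^ (c.t * j) * ((c.t * c.k : ℕ) : ℝ) ^ c.t ≤ ((c.k : ℝ) ^ (4 / ν)) ^ (c.t * j) := by
    have h1 : ((c.t * c.k : ℕ) : ℝ) ^ c.t ≤ ((c.t * c.k : ℕ) : ℝ) ^ (c.t * j) :=
      pow_le_pow_right₀ hTK1 (Nat.le_mul_of_pos_right _ hj1)
    calc B₀ ^ (c.t * j) * ((c.t * c.k : ℕ) : ℝ) ^ c.t ≤ B₀ ^ (c.t * j) * ((c.t * c.k : ℕ) : ℝ) ^ (c.t * j) :=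
          mul_le_mul_of_nonneg_left h1 (by positivity)
      _ = (B₀ * ((c.t * c.k : ℕ) : ℝ)) ^ (c.t * j) := (mul_pow _ _ _).symm
      _ ≤ ((c.k : ℝ) ^ (4 / ν)) ^ (c.t * j) := pow_le_pow_left₀ (by positivity) hB _
  -- Step 4: `(k^{4/ν})^{tj} ≤ exp(4 tj log k · α^{L-(j+1)}/η)`
  set ae : ℝ := c.α ^ (c.L - (j + 1)) with hae
  have hae0 : 0 < ae := c.α_pow_pos _
  have step4 : ((c.k : ℝ) ^ (4 / ν)) ^ (c.t * j) ≤ Real.exp (4 * ((c.t * j : ℕ) : ℝ) * Real.log c.k * ae / c.η) := by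
    rw [← Real.rpow_natCast, ← Real.rpow_mul hk0.le, Real.rpow_def_of_pos hk0, Real.exp_le_exp]
    -- `log k · (4/ν · tj) ≤ 4 tj log k · ae/η` ⟸ `1/ν ≤ ae/η`
    have hlogk : 0 ≤ Real.log c.k := by linarith [c.log_k_ge]
    have hνge : c.η / ae ≤ ν := by
      -- `ν = log R / log M ≥ log R / log P_{j+1} = η/ae`
      have hPw : Real.log (c.Pw (j + 1)) = ae * Real.log c.P := by unfold Pw; rw [Real.log_rpow c.P_pos]
      have hlogM : Real.log M ≤ ae * Real.log c.P := by rw [← hPw]; exact Real.log_le_log hM0 hMP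
      have hlogM0 : 0 < Real.log M := Real.log_pos hM1
      rw [hν]; unfold L42Ctx.ν
      rw [c.logR_eq, div_le_div_iff₀ hae0 hlogM0]
      have := c.hη; nlinarith
    have h1 : 1 / ν ≤ ae / c.η := by
      rw [div_le_div_iff₀ hν0 c.hη]; rw [div_le_iff₀ hae0] at hνge; linarith
    have htj0 : 0 ≤ ((c.t * j : ℕ) : ℝ) := Nat.cast_nonneg _
    calc Real.log c.k * (4 / ν * ((c.t * j : ℕ) : ℝ)) = (4 * ((c.t * j : ℕ) : ℝ) * Real.log c.k) * (1 / ν) := by ring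
      _ ≤ (4 * ((c.t * j : ℕ) : ℝ) * Real.log c.k) * (ae / c.η) := mul_le_mul_of_nonneg_left h1 (by positivity)
      _ = _ := by ring
  -- Step 5: the `M`-exponent
  have step5 : (M ^ (1 / (c.h : ℝ)) * M) ^ (c.t * j) * M ^ c.t = M ^ c.X (j + 1) * M ^ (-(c.t * fj c.h (j + 1))) := by
    rw [← Real.rpow_add hM0, ← Real.rpow_natCast M c.t]
    have e1 : M ^ (1 / (c.h : ℝ)) * M = M ^ (1 / (c.h : ℝ) + 1) := by rw [Real.rpow_add hM0, Real.rpow_one]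
    rw [e1, ← Real.rpow_mul_natCast hM0.le, ← Real.rpow_add hM0]
    congr 1
    have := c.X_succ_sub j
    push_cast; linear_combination -this
  -- Step 6: `M^{-tf} ≤ P^{-ae t f} R^{h t f}` and `R^{htf} ≤ (e²R)^{t C(j+1,2)}`
  have hf0 : 0 ≤ fj c.h (j + 1) := fj_nonneg (h := c.h) (by linarith [c.h_geR]) (j + 1) (by omega)
  have hfle : (c.h : ℝ) * fj c.h (j + 1) ≤ ((j + 1).choose 2 : ℕ) := by
    have h1 := fj_le (h := c.h) (by linarith [c.h_geR]) (j := j + 1) (by omega)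
    have hh := c.h_pos
    have h1' := (le_div_iff₀ (by positivity : (0:ℝ) < 2 * c.h)).1 h1
    have hC2 : (((j + 1).choose 2 : ℕ) : ℝ) * 2 = ((j : ℝ) + 1) * j := by
      have := Nat.add_one_mul_choose_eq j 1; rw [Nat.choose_one_right] at this; exact_mod_cast this.symm
    push_cast at h1'
    nlinarith
  have hlow : c.P ^ ae * c.R ^ (-(c.h : ℝ)) ≤ M := by
    refine le_trans ?_ hM
    unfold Mw; rw [← hae]
    refine mul_le_mul_of_nonneg_left (Real.rpow_le_rpow_of_exponent_le c.one_lt_R.le ?_) (Real.rpow_nonneg c.P_pos.le _)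
    have := c.α_pow_le_one (c.L - (j + 1)); have := c.h_pos; nlinarith
  have hlow0 : 0 < c.P ^ ae * c.R ^ (-(c.h : ℝ)) := mul_pos (Real.rpow_pos_of_pos c.P_pos _) (Real.rpow_pos_of_pos c.R_pos _)
  have step6 : M ^ (-(c.t * fj c.h (j + 1))) ≤ c.P ^ (-(ae * (c.t * fj c.h (j + 1)))) * (Real.exp 2 * c.R) ^ (c.t * (j + 1).choose 2) := by
    have h1 : M ^ (-(c.t * fj c.h (j + 1))) ≤ (c.P ^ ae * c.R ^ (-(c.h : ℝ))) ^ (-(c.t * fj c.h (j + 1))) :=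
      Real.rpow_le_rpow_of_nonpos hlow0 hlow (by have := c.t_pos; nlinarith)
    have h2 : (c.P ^ ae * c.R ^ (-(c.h : ℝ))) ^ (-(c.t * fj c.h (j + 1)))
        = c.P ^ (-(ae * (c.t * fj c.h (j + 1)))) * c.R ^ ((c.h : ℝ) * (c.t * fj c.h (j + 1))) := by
      rw [Real.mul_rpow (Real.rpow_nonneg c.P_pos.le _) (Real.rpow_nonneg c.R_pos.le _), ← Real.rpow_mul c.P_pos.le,
        ← Real.rpow_mul c.R_pos.le]
      have e1 : ae * -(c.t * fj c.h (j + 1)) = -(ae * (c.t * fj c.h (j + 1))) := by ring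
      have e2 : -(c.h : ℝ) * -(c.t * fj c.h (j + 1)) = (c.h : ℝ) * (c.t * fj c.h (j + 1)) := by ring
      rw [e1, e2]
    have h3 : c.R ^ ((c.h : ℝ) * (c.t * fj c.h (j + 1))) ≤ (Real.exp 2 * c.R) ^ (c.t * (j + 1).choose 2) := by
      have hexp : (c.h : ℝ) * (c.t * fj c.h (j + 1)) ≤ (((c.t * (j + 1).choose 2 : ℕ)) : ℝ) := by
        rw [Nat.cast_mul]
        calc (c.h : ℝ) * (c.t * fj c.h (j + 1)) = c.t * (c.h * fj c.h (j + 1)) := by ring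
          _ ≤ c.t * (((j + 1).choose 2 : ℕ) : ℝ) := mul_le_mul_of_nonneg_left hfle c.t_pos.le
      calc c.R ^ ((c.h : ℝ) * (c.t * fj c.h (j + 1))) ≤ c.R ^ (((c.t * (j + 1).choose 2 : ℕ)) : ℝ) :=
            Real.rpow_le_rpow_of_exponent_le c.one_lt_R.le hexp
        _ = c.R ^ (c.t * (j + 1).choose 2) := Real.rpow_natCast _ _
        _ ≤ (Real.exp 2 * c.R) ^ (c.t * (j + 1).choose 2) := by
            refine pow_le_pow_left₀ c.R_pos.le ?_ _
            have := one_le_exp_two; have := c.R_pos; nlinarith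
    rw [h2] at h1
    exact h1.trans (mul_le_mul_of_nonneg_left h3 (Real.rpow_nonneg c.P_pos.le _))
  -- Step 7: the exponentials combine to `exp(t E_{j+1})`
  have step7 : Real.exp (4 * ((c.t * j : ℕ) : ℝ) * Real.log c.k * ae / c.η) * c.P ^ (-(ae * (c.t * fj c.h (j + 1))))
      = Real.exp (c.t * c.E (j + 1)) := by
    rw [Real.rpow_def_of_pos c.P_pos, ← Real.exp_add]
    congr 1
    unfold E; rw [← hae]; push_cast; ring
  have hE := c.exp_le_Cseq (j := j + 1) (by omega)
  -- assemble
  have hMX : 0 ≤ M ^ c.X (j + 1) := Real.rpow_nonneg hM0.le _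
  calc (B₀ ^ (c.t * j) * ((c.t * c.k : ℕ) : ℝ) ^ c.t) * c.K₁ ^ (c.t * (j + 1)) * ((M ^ (1 / (c.h : ℝ)) * M) ^ (c.t * j) * M ^ c.t)
      ≤ Real.exp (4 * ((c.t * j : ℕ) : ℝ) * Real.log c.k * ae / c.η) * c.K₁ ^ (c.t * (j + 1)) *
          (M ^ c.X (j + 1) * M ^ (-(c.t * fj c.h (j + 1)))) := by
        rw [step5]
        exact mul_le_mul_of_nonneg_right (mul_le_mul_of_nonneg_right (step3.trans step4) (by positivity)) (by positivity)
    _ ≤ Real.exp (4 * ((c.t * j : ℕ) : ℝ) * Real.log c.k * ae / c.η) * c.K₁ ^ (c.t * (j + 1)) *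
          (M ^ c.X (j + 1) * (c.P ^ (-(ae * (c.t * fj c.h (j + 1)))) * (Real.exp 2 * c.R) ^ (c.t * (j + 1).choose 2))) := by
        exact mul_le_mul_of_nonneg_left (mul_le_mul_of_nonneg_left step6 hMX) (by positivity)
    _ = c.K₁ ^ (c.t * (j + 1)) * (Real.exp (4 * ((c.t * j : ℕ) : ℝ) * Real.log c.k * ae / c.η) * c.P ^ (-(ae * (c.t * fj c.h (j + 1)))))
          * (Real.exp 2 * c.R) ^ (c.t * (j + 1).choose 2) * M ^ c.X (j + 1) := by ring
    _ ≤ c.K₁ ^ (c.t * (j + 1)) * c.Cseq (j + 1) * (Real.exp 2 * c.R) ^ (c.t * (j + 1).choose 2) * M ^ c.X (j + 1) := by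
        rw [step7]; gcongr

/-- **Inductive step `j → j+1`.** [cite: Ford2002, proof of Lemma 4.2 ("Next assume j ≥ 2, (4.13) holds
with j replaced by j−1")] -/
theorem claim_succ (hj1 : 1 ≤ j) (hj : j + 1 ≤ c.L) (ih : c.Claim j) : c.Claim (j + 1) := by
  intro M hM hMP
  obtain ⟨hM1, hMP', -, hν0, -⟩ := c.range_facts (i := j + 1) (by omega) hj hM hMP
  obtain ⟨m', hm'⟩ : ∃ m', c.t * j = m' + 1 :=
    ⟨c.t * j - 1, by have : 1 ≤ c.t * j := Nat.one_le_iff_ne_zero.2 (Nat.mul_ne_zero (by have := c.ht1; omega) (by omega)); omega⟩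
  have h41 := ford_lemma41 (k := c.k) (h := c.h) (t := c.t) (m' := m') c.one_le_h c.ht1 c.hkt (P := M) (R := c.R)
    (η := c.ν M) hM1.le hν0 (c.R_eq_rpow_ν hM1) c.k_lt_sqrt_R (c.card_C_ge_64 hM hMP')
  have eH : c.H (j + 1) M = (Jinc c.k (c.t + (m' + 1)) ((smoothSet M c.R).map Nat.castEmbedding) c.h c.k : ℝ) := by
    unfold H; rw [← hm', mul_add, mul_one, add_comm]
  rw [eH]
  refine h41.trans (max_le ?_ ?_)
  · have hRM : c.R ≤ M := (c.R_le_Mw (j + 1)).trans hM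
    have hνη₁ : c.ν M ≤ c.η₁ := c.ν_le_η₁ (by omega) hj hM
    have hCK : ((smoothSet M c.R).card : ℝ) ≤ M * c.K₁ :=
      (c.card_C_le hRM hM1 hMP').trans (mul_le_mul_of_nonneg_left (c.cν_le_K₁ hM1 hνη₁) (by linarith))
    exact c.T1_le hj1 hj hM hMP hm' (by positivity) (Nat.cast_nonneg _) hCK (c.B0_tk_le hj1 hj hM hMP hm')
  · exact c.T2_le hj1 hj ih hM hMP hm'

/-- **(4.13) for every `1 ≤ j ≤ L`.** [cite: Ford2002, (4.13)] -/
theorem claim_all : ∀ j : ℕ, 1 ≤ j → j ≤ c.L → c.Claim j := by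
  intro j hj1
  induction j, hj1 using Nat.le_induction with
  | base => intro _; exact c.claim_one
  | succ j hj1 ih => intro hjL; exact c.claim_succ hj1 hjL (ih (by omega))

end Induction

/-- **Lemma 4.2 for the context** (`j = L`, `M = P`). [cite: Ford2002, Lemma 4.2] -/
theorem main :
    (Jinc c.k (c.t * c.L) ((smoothSet c.P c.R).map Nat.castEmbedding) c.h c.k : ℝ)
      ≤ (12 * c.η) ^ ((c.t * c.L : ℝ) * ((1 / c.η + c.h) * (1 - 1 / (c.h : ℝ)) ^ (c.L - 1) - c.h)) * c.Cseq c.L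
        * (Real.exp 2 * c.R) ^ (c.t * (c.L).choose 2) * c.P ^ ((c.t : ℝ) * (2 * c.L - c.h * (1 - (1 - 1 / (c.h : ℝ)) ^ c.L))) := by
  have h := c.claim_all c.L c.hL1 le_rfl c.P (by rw [c.Mw_L]) (by rw [c.Pw_L])
  unfold H at h
  refine h.trans (le_of_eq ?_)
  have hK : c.K₁ ^ (c.t * c.L) = (12 * c.η) ^ ((c.t * c.L : ℝ) * ((1 / c.η + c.h) * (1 - 1 / (c.h : ℝ)) ^ (c.L - 1) - c.h)) := by
    unfold K₁
    rw [← Real.rpow_natCast, ← Real.rpow_mul (by have := c.hη; positivity), c.inv_η₁]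
    congr 1; push_cast; unfold α; ring
  rw [hK]; rfl

end L42Ctx

/-- **Ford's Lemma 4.2 (library constants).** Let `k ≥ 60`, `h + t = k + 1`, `1 ≤ t`, `6t ≤ k`,
`1 ≤ L`, `2L ≤ h`, `0 < η`, `3ηh ≤ 2`, `P > 1`, `R = P^η ≥ max((2/η)³, e⁴⁰)`, and suppose
`|𝒞(Q,R)| ≥ Q^{1/2}` for `P^{1/3} ≤ Q ≤ P`. Then, with `α = 1 − 1/h`,
`J_{Lt,k,h}(𝒞(P,R)) ≤ (12η)^{tL((1/η+h)α^{L−1} − h)} C_L (e²R)^{t·C(L,2)} P^{t(2L − h(1−α^L))}`,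
where `C_1 = (tk)^t`, `C_j = max(C_{j−1}, e^{tE_j})`,
`E_j = α^{L−j}[(4 log k/η)(j−1) − f_j log P]` (`FordVK.L42Ctx.Cseq`, `.E`). (Ford: `10η`, `C_1 = k^t`.)
[cite: Ford2002, Lemma 4.2] -/
theorem ford_lemma42 (c : L42Ctx) :
    (Jinc c.k (c.t * c.L) ((smoothSet c.P c.R).map Nat.castEmbedding) c.h c.k : ℝ)
      ≤ (12 * c.η) ^ ((c.t * c.L : ℝ) * ((1 / c.η + c.h) * (1 - 1 / (c.h : ℝ)) ^ (c.L - 1) - c.h)) * c.Cseq c.L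
        * (Real.exp 2 * c.R) ^ (c.t * (c.L).choose 2) * c.P ^ ((c.t : ℝ) * (2 * c.L - c.h * (1 - (1 - 1 / (c.h : ℝ)) ^ c.L))) :=
  c.main

end FordVK
end Literature.NumberTheory.LFunctions
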